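import Literature.MathematicalPhysics.QuantumFieldTheory.Balaban1983to89.B9SectCDiffCutModelToy3

/-!
# `Balaban1983to89.B9SectCDiffCutModelToy4` — the LEIBNIZ BLOCK of the cut model WITH CONTENT: a non-zero lattice
difference `∂ = S − 1` on the one-level toy line, the EXACT Leibniz identities of the `CutModel.hΛ / hM / hA` shapes
with NON-ZERO coefficient operators (`Θ_h + SᵀΘ_h` of order −1, `Ξ_h` of order −2), their h-free records and zone
classes at `θ_L = (3/2)(1/M)(1 + e^{δ₀}) + 6/M²` for a `C¹` cutoff, and the sharp observation that the
piecewise-linear ramp reaches only `𝒵(−2, B/M)` (item (a⁗) of the census `b2b-balaban-r1/SectC-inst-census.md` §6,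
v1.5: "D2-lite with content")

B9 = T. Bałaban, *Propagators for lattice gauge theories in a background field*, Commun. Math. Phys. **99**, 389–434
(1985) [Balaban1985BackgroundPropagators].

CITATION HEADER (lean-in-tree rule 2026-08-18).  Cell `pub-balaban`, unit `b2b-balaban-r1-g16` (READER GROUP A,
lineage r1, gen 16), journal claim `SECTC-DIFF-CUTMODEL-TOY4`.  Source: doi:10.1007/bf01240355, held
`paper:balaban1985-cmp99-background-propagators`, journal page = PDF page + 388.  This unit re-read NO page and
introduces NO quotation: the sentences whose SHAPES are inhabited here are quoted VERBATIM in
`…B9SectCDiffCutModel`'s header — p. 413 [PDF 25] (3.100) (the expansion of the difference of two cut operators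
into defect terms) and p. 414 [PDF 26] (3.102) with the sentence on the coefficient operators *"… with coefficients
determined by derivatives of the function h … of the order O(M⁻¹), or O(M⁻²), if considered on a proper scale"* —
and the page tags on the declarations below point to those quotations BY NAME; they are copied from the tagged tree
declarations whose hypothesis shapes they instantiate (`CutModel.lD`, `lDt`, `hΛ`, `zLm₁`, `zLm₀`, `hM`, `zDm₁`,
`zDm₀`, `hA`, `zAm₁`, `zAm₀`, `modulus`, `zone`, `farS₁`; `opZon_of_geom`).  Tree inputs (by name):
`B9SectCDiff.{tdef, cutX, tdef_def, tdef_mul, tdef_add, tdef_smul, tdef_one}`, `B9SectCDiffEstimate.{Frame,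
Frame.Valid, OpZon}`, `B9SectCDiffCutModel.{OpConst, OpLoc, opZon_of_geom, cutX_id_id}`,
`B9SectCDiffDict.{opZon_of_local, opZon_add, opZon_mono}`, `B9SectCDiffCutModelToy.{pos, dE, bdist,
bdist_isPseudoDist, bdist_self, ramp, ramp_nonneg, ramp_le_one, ramp_eq_zero_of_le, ramp_eq_one_of_ge,
ramp_lipschitz, ramp_eq_of_mem, ramp_zone, ramp_far, hcut, lineFrame, rampZone, rampZone_nonempty}`,
`B9SectCDiffCutModelToy2.{dE_comm, dE_self, S2, p2, bs2}`, `B9SectCDiffCutModelToy3.{toyFrame, toyFrame_valid,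
toyFrame_ρ, toyFrame_β, toyFrame_sc, toyFrame_δ₀, opLoc_toy}`; Mathlib's `finProdFinEquiv` and `Matrix` algebra
otherwise.  Cell rows: GAPS C-r1g13-1 (the cut model), C-r1g14-1 / C-r1g15-1 / C-r1g15-2 (the toys), this module's
row C-r1g16-1; census `b2b-balaban-r1/SectC-inst-census.md` §5 (D2, N8–N10) / §6 (a⁗).  No `HarnessLib` fact, no
named-fact `Prop`, no hypothesis structure, no `instance` introduced; no `sorry`.

## WHAT THIS MODULE DOES

Gens 13–15 typed the cut model (`CutModel`, 76 fields) and inhabited it on the one-level block line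
`Fin n × Fin B` (blocks `I : Fin n` of `B` sites) with a DEGENERATE differential block: `∂ = 0`, so the three Leibniz
identities `hΛ : 𝔇(Λ) = Lm₁·Dv + Lm₀`, `hM : ∂·𝔇(∂*) = Dm₁·Dv + Dm₀`, `hA : 𝔇(Δ′) = Am₁·∂ + Am₀` held with ZERO
coefficient operators (census §5, D2 untouched).  This leaf supplies the lattice calculus:
* §1 the linear index `ι (I, o) = o + B·I` (`finProdFinEquiv`), `site`, successor/predecessor pairs
  (`exists_succ`, `exists_pred`), blocks of neighbours (`bdist_le_one_of_succ`: `|I_x − I_{x+1}| ≤ 1`), `dE = |Δι|`;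
* §2 the shift `S` (`Sh`), **`∂ := S − 1`** (`Dfw`, forward difference, Dirichlet at the right end — an INVERTIBLE
  non-zero nearest-neighbour operator), **`∂* := Sᵀ − 1 = ∂ᵀ`** (`Dbw`), the forward differences `θ_h` of a
  function `h` on the sites (`fd`), their shift `θ_h(· − 1)` (`bfd`), the second differences `ξ_h = θ_h − θ_h(· − 1)`
  (`sd`), `Θ_h = diag θ_h` (`Th`), `Ξ_h = diag ξ_h` (`Xi`, `= Θ_h − SᵀΘ_hS`, `Xi_eq`), `S·Sᵀ = 1 − E_last`,
  `Θ_h·E_last = 0`; and the EXACT identities, for EVERY `h` (`H = diag h`, `𝔇(T) = H·T − T·H = tdef H H T T`):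
  **`dD_eq : 𝔇(∂) = −Θ_h·S`**, **`dDt_eq : 𝔇(∂*) = Sᵀ·Θ_h`**,
  **`D_mul_dDt : ∂·𝔇(∂*) = (SᵀΘ_h)·∂ + Ξ_h`** (the `hM` shape: `Dm₁ = SᵀΘ_h`, `Dm₀ = Ξ_h`, `Dv = ∂`),
  **`dDDt_eq : 𝔇(∂∂*) = (Θ_h + SᵀΘ_h)·∂ + Ξ_h`** (the `hΛ` shape for `Λ = ∂∂*`),
  **`dDtD_eq : 𝔇(∂*∂) = (Θ_h + SᵀΘ_h)·∂ + Ξ_h`** (the `hA` shape for `Δ′ = ∂*∂ + m²`), `leibniz_affine`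
  (`Λ = a·1 + b·∂∂*`, `Δ′ = ∂*∂ + m²·1`); row-sum facts `sum_abs_Dfw_le` / `sum_abs_Dbw_le` (`≤ 2`);
* §3 **the h-free records of `∂`, `∂*` with NON-ZERO constants**: `opLoc_nn` (entries at distance `≤ 1`, absolute
  row sums `≤ 2` ⇒ `OpLoc (lineFrame …) id id dE (ℓ ≡ B) (−1) ⟨1, 0, 2e^{δ₀}⟩ T id id id fst fst`: range `1·B⁰`,
  radius `1 ≤ B`, block row sums `≤ 2 ≤ 2e^{δ₀}·B^{(−1)+1−0}·e^{−δ₀|I−J|}`), `opLoc_Dfw` (the `lD` shape),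
  `opLoc_Dbw` (the `lDt` shape), the column-block refinement `opLoc_refine` (finer column blocks only shrink block
  row sums) and `opLoc_Dfw₂` (gen 15's sequence-2 blocks `bs2 / p2`);
* §4 **the zone classes of the coefficient operators**, for a general cutoff `h` given ONLY the two `CutModel`
  facts `modulus` (`|h(e) − h(e′)| ≤ ω₀·sc⁻¹·dE` within radius `B`) and `zone` (`h(e) ≠ h(e′)` within radius `B` ⇒
  `β(I_e) = 0`), for ANY block maps over the block projection (sequence 1 and 2 alike): the local-operator engine
  `opZon_local_toy` (≤ 1 entry per row at block distance `≤ R`, size `≤ θ₁Bᵏ`, zone rows ⇒ `𝒵(k, θ₁e^{δ₀R})`, by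
  `opZon_of_local`); **`opZon_Th : Θ_h ∈ 𝒵(−1, ω₀)`**, **`opZon_transpose_mul_Th : SᵀΘ_h ∈ 𝒵(−1, ω₀e^{δ₀})`**,
  **`opZon_Lm₁ : Θ_h + SᵀΘ_h ∈ 𝒵(−1, ω₀(1 + e^{δ₀}))`**, and **`opZon_Xi : Ξ_h ∈ 𝒵(−2, ω₁)` GIVEN a second-modulus
  bound `|ξ_h| ≤ ω₁B⁻²`**; and `dD_opZon` / `dDt_opZon` / `dD_opZon_diag`: **`𝔇(∂), 𝔇(∂*) ∈ 𝒵(−1, 2ω₀e^{δ₀})` BY THE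
  GEOMETRIC ZONE DICTIONARY `opZon_of_geom`** from the records of §3 (the `CutModel.toLDat` route of gen 13, for the
  first time with `D ≠ 0`; consistent with the direct class of `−Θ_hS` up to the record's row-sum factor 2);
* §5 cutoffs: the ramp is monotone with lattice increments in `[0, 1/(MB)]` (`ramp_step`), trichotomy at lattice
  positions (`ramp_trichotomy`); **`abs_sd_hcut_le : |ξ_{hcut}| ≤ 1/(MB)`** and **`sd_hcut_kink`: the value `1/(MB)
  = (B/M)·B⁻²` IS ATTAINED** at the left end of the ramp — the piecewise-linear cutoff's order-(−2) coefficient is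
  only `𝒵(−2, B/M)` (`hcut_zXi`), a `B`-DEPENDENT size; the smoothstep `sstep r = 3r² − 2r³` (`|f(s) − f(t)| ≤
  (3/2)|s − t|` on `[0,1]`, `f ≤ 3r²`, `1 − f ≤ 3(1 − r)²`, `f(v+a) − 2f(v) + f(v−a) = 6a²(1 − 2v)`) and the `C¹`
  cutoff **`h4 := sstep ∘ hcut`** with the three `CutModel` cutoff facts `h4_modulus` (`ω₀ = (3/2)(1/M)`), `h4_zone`,
  `h4_far`, and **`abs_sd_h4_le : |ξ_{h₄}| ≤ 6/(MB)²`** (window inside the line, `I₀ + M < n`; proof by the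
  trichotomy `v ∈ {0} ∪ (0,1) ∪ {1}` and INTEGRALITY of positions: inside the window both neighbours are unclamped);
* §6 **the Leibniz block inhabited**: with `θ_L := (3/2)(1/M)(1 + e^{δ₀}) + 6/M²` (`thetaL`, `O(M⁻¹)` uniformly in
  `B`, `n`, `I₀`), on `toyFrame n B (rampZone n M I₀) _ δ₀` and for any block maps over the block projection:
  **`h4_zLm₁ : Θ + SᵀΘ ∈ 𝒵(−1, θ_L)`** (the `zLm₁`/`zAm₁` content), **`h4_zLm₀ : Ξ ∈ 𝒵(−2, θ_L)`** (`zLm₀`/`zDm₀`/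
  `zAm₀`), **`h4_zDm₁ : SᵀΘ ∈ 𝒵(−1, θ_L)`** (`zDm₁`), next to the identities of §2 (`leibniz_affine`): every
  Leibniz-block field shape of `CutModel` is inhabited with `∂ ≠ 0` and non-zero coefficient operators whose sizes
  are COMPUTED (`O(M⁻¹)`, resp. `O(M⁻²)·B⁰`, on the proper scale), not postulated.

## WHAT IS NOT CLAIMED (ABSOLUTE RULE)

Nothing printed is asserted.  This is one-dimensional nearest-neighbour lattice calculus (folklore) on a TOY line;
B9's (3.100)/(3.102) concern gauge-covariant operators on a 4-dimensional lattice with multi-level averaging, and the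
coefficient operators there are not diagonal.  NO `CutModel` / `TwoSeq` / `EstHyp` instance with `∂ ≠ 0` is built:
with a non-zero `∂` the inverse-side data `G′ = (Δ′)⁻¹`, `C = E⁻¹`, `G` need genuine off-diagonal decay of lattice
resolvents (the content of B9's Theorems 3.2/3.3, (3.42)/(3.48)), which is the next census item (§6 (a⁵), note N10)
and is NOT attempted here; the cheap alternatives (hiding `∂P∂*` in `A` or in `Λ`) fail with `B`-dependent constants
(census note N9).  Whether the printed cutoff `h` of p. 408 has bounded second differences on the proper scale is NOT
adjudicated; §5 only shows that the *"O(M⁻²)"* size of the order-(−2) coefficient REQUIRES such a bound beyond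
`CutModel.modulus` (ramp: `B/M` attained; `h₄`: `6/M²`).  The factor `e^{δ₀}` in `θ_L` pays for the one sub-diagonal
entry per block boundary and is harmless for fixed `δ₀` but recorded.  `toyFrame` is reused as typed in gen 15 (its
`u = δ₀/20` makes `Frame.σ = 0` downstream, census note to C-pv15g8-10 R1) — immaterial here, where only
`Frame.rate 0 = δ₀` enters.  Value = the kernel certificate that the Leibniz block of the 76-field `CutModel` is
satisfiable WITH CONTENT and with constants computed from an explicit cutoff — NOT summit progress.
-/

namespace Literature.MathematicalPhysics.QuantumFieldTheory.Balaban1983to89.B9SectCDiffCutModelToy4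

open Finset Real
open B9SectCDiffEstimate
open B9SectCDiffCutModel
open B9SectCDiffCutModelToy
open B9SectCDiffCutModelToy2
open B9SectCDiffCutModelToy3
open B9SectCDiff (tdef cutX)

noncomputable section

/-! ## §1 The toy line: linear index, successor pairs, blocks of neighbours -/

section Line

variable {n B : ℕ}

/-- the linear index of a site of the toy line: `ι (I, o) = o + B·I` (`= pos`, as a natural number), via
`finProdFinEquiv : Fin n × Fin B ≃ Fin (n·B)`. OURS (typing). [folklore] -/
def ι (x : Fin n × Fin B) : ℕ := (finProdFinEquiv x).val

/-- [folklore] -/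
theorem ι_eq (x : Fin n × Fin B) : ι x = x.2.val + B * x.1.val := rfl

/-- [folklore] -/
theorem ι_lt (x : Fin n × Fin B) : ι x < n * B := (finProdFinEquiv x).isLt

/-- [folklore] -/
theorem ι_injective : Function.Injective (ι : Fin n × Fin B → ℕ) := fun _ _ h =>
  finProdFinEquiv.injective (Fin.ext h)

/-- [folklore] -/
theorem ι_inj {x y : Fin n × Fin B} : ι x = ι y ↔ x = y := ι_injective.eq_iff

/-- the site with a given linear index. OURS (typing). [folklore] -/
def site (k : ℕ) (hk : k < n * B) : Fin n × Fin B := finProdFinEquiv.symm ⟨k, hk⟩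

/-- [folklore] -/
@[simp] theorem ι_site (k : ℕ) (hk : k < n * B) : ι (site k hk : Fin n × Fin B) = k := by
  unfold ι site; rw [Equiv.apply_symm_apply]

/-- the real position of gen 14 is the linear index. [folklore] -/
theorem pos_eq_ι (x : Fin n × Fin B) : pos n B x = (ι x : ℝ) := by
  rw [ι_eq]; unfold pos; push_cast; ring

/-- the distance-like function of gen 14 is the distance of the linear indices. [folklore] -/
theorem dE_eq_ι (x y : Fin n × Fin B) : dE n B x y = |(ι x : ℝ) - (ι y : ℝ)| := by
  unfold dE; rw [pos_eq_ι, pos_eq_ι]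

/-- a successor exists iff the index is not the last one. [folklore] -/
theorem exists_succ {x : Fin n × Fin B} (h : ι x + 1 < n * B) : ∃ y : Fin n × Fin B, ι y = ι x + 1 :=
  ⟨site (ι x + 1) h, ι_site _ _⟩

/-- a predecessor exists iff the index is positive. [folklore] -/
theorem exists_pred {y : Fin n × Fin B} (h : 0 < ι y) : ∃ x : Fin n × Fin B, ι y = ι x + 1 := by
  refine ⟨site (ι y - 1) (by have := ι_lt y; omega), ?_⟩
  rw [ι_site]; omega

/-- blocks are monotone in the linear index. [folklore] -/
theorem fst_le_of_ι_le {x y : Fin n × Fin B} (h : ι x ≤ ι y) : x.1.val ≤ y.1.val := by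
  rw [ι_eq, ι_eq] at h
  by_contra hc
  have h1 : y.1.val + 1 ≤ x.1.val := Nat.lt_of_not_le hc
  have h2 : y.2.val < B := y.2.isLt
  have h3 : B * (y.1.val + 1) ≤ B * x.1.val := Nat.mul_le_mul_left _ h1
  rw [Nat.mul_add, Nat.mul_one] at h3
  omega

/-- a site at index distance `≤ B` to the right lies in the same or the next block. [folklore] -/
theorem fst_le_succ_of_ι_le {x y : Fin n × Fin B} (h : ι y ≤ ι x + B) : y.1.val ≤ x.1.val + 1 := by
  rw [ι_eq, ι_eq] at h
  by_contra hc
  have h1 : x.1.val + 2 ≤ y.1.val := Nat.lt_of_not_le hc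
  have h2 : x.2.val < B := x.2.isLt
  have h3 : B * (x.1.val + 2) ≤ B * y.1.val := Nat.mul_le_mul_left _ h1
  rw [Nat.mul_add] at h3
  omega

/-- **neighbours lie in the same or in adjacent blocks**: `ι y = ι x + 1 ⇒ |I_x − I_y| ≤ 1`. [folklore] -/
theorem bdist_le_one_of_succ {x y : Fin n × Fin B} (h : ι y = ι x + 1) : bdist n x.1 y.1 ≤ 1 := by
  have h1 : x.1.val ≤ y.1.val := fst_le_of_ι_le (by omega)
  have h2 : y.1.val ≤ x.1.val + 1 := fst_le_succ_of_ι_le (by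
    have : 1 ≤ B := Nat.one_le_iff_ne_zero.2 (by rintro rfl; have := ι_lt x; simp at this)
    omega)
  unfold bdist
  have h1' : (x.1.val : ℝ) ≤ y.1.val := by exact_mod_cast h1
  have h2' : (y.1.val : ℝ) ≤ x.1.val + 1 := by exact_mod_cast h2
  rw [abs_le]; constructor <;> linarith

/-- the distance of neighbours is `1`. [folklore] -/
theorem dE_of_succ {x y : Fin n × Fin B} (h : ι y = ι x + 1) : dE n B x y = 1 ∧ dE n B y x = 1 := by
  rw [dE_eq_ι, dE_eq_ι, h, Nat.cast_add, Nat.cast_one]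
  constructor
  · rw [show ((ι x : ℝ) - (ι x + 1)) = -1 by ring, abs_neg, abs_one]
  · rw [show ((ι x : ℝ) + 1 - ι x) = 1 by ring, abs_one]

end Line

/-! ## §2 Shift, forward/backward differences, the diagonal of forward differences of a cutoff -/

section Ops

variable {n B : ℕ}

/-- THE SHIFT `(S f)(x) = f(x + 1)` on the toy line (zero at the last site). OURS (typing). [folklore] -/
def Sh (n B : ℕ) : Matrix (Fin n × Fin B) (Fin n × Fin B) ℝ := fun x y => if ι y = ι x + 1 then 1 else 0

/-- [folklore] -/
theorem Sh_apply (x y : Fin n × Fin B) : Sh n B x y = if ι y = ι x + 1 then 1 else 0 := rfl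

/-- a row of the shift is the indicator of the successor. [folklore] -/
theorem Sh_eq_indicator {x y : Fin n × Fin B} (hy : ι y = ι x + 1) (z : Fin n × Fin B) :
    Sh n B x z = if z = y then 1 else 0 := by
  rw [Sh_apply]
  by_cases hz : z = y
  · rw [if_pos hz, if_pos (hz ▸ hy)]
  · rw [if_neg hz, if_neg]
    intro h
    exact hz (ι_inj.1 (h.trans hy.symm))

/-- `Σ_z S(x,z)·g(z) = g(x + 1)`. [folklore] -/
theorem sum_Sh_mul {x y : Fin n × Fin B} (hy : ι y = ι x + 1) (g : Fin n × Fin B → ℝ) :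
    ∑ z, Sh n B x z * g z = g y := by
  simp_rw [Sh_eq_indicator hy, ite_mul, one_mul, zero_mul]
  rw [Finset.sum_ite_eq', if_pos (mem_univ _)]

/-- … and `= 0` at the last site. [folklore] -/
theorem sum_Sh_mul_of_last {x : Fin n × Fin B} (hx : ∀ y : Fin n × Fin B, ι y ≠ ι x + 1)
    (g : Fin n × Fin B → ℝ) : ∑ z, Sh n B x z * g z = 0 :=
  sum_eq_zero fun z _ => by rw [Sh_apply, if_neg (hx z), zero_mul]

/-- `Σ_z g(z)·S(z,y) = g(y − 1)`. [folklore] -/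
theorem sum_mul_Sh {x y : Fin n × Fin B} (hy : ι y = ι x + 1) (g : Fin n × Fin B → ℝ) :
    ∑ z, g z * Sh n B z y = g x := by
  have h : ∀ z, Sh n B z y = if z = x then 1 else 0 := by
    intro z
    rw [Sh_apply]
    by_cases hz : z = x
    · rw [if_pos hz, if_pos (hz ▸ hy)]
    · rw [if_neg hz, if_neg]
      intro h'
      exact hz (ι_inj.1 (by omega))
  simp_rw [h, mul_ite, mul_one, mul_zero]
  rw [Finset.sum_ite_eq', if_pos (mem_univ _)]

/-- … and `= 0` at the first site. [folklore] -/
theorem sum_mul_Sh_of_first {y : Fin n × Fin B} (hy : ∀ x : Fin n × Fin B, ι y ≠ ι x + 1)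
    (g : Fin n × Fin B → ℝ) : ∑ z, g z * Sh n B z y = 0 :=
  sum_eq_zero fun z _ => by rw [Sh_apply, if_neg (hy z), mul_zero]

/-- THE FORWARD DIFFERENCE `∂ = S − 1`: `(∂f)(x) = f(x+1) − f(x)` (with `f ≡ 0` beyond the last site).
OURS (typing). [folklore] -/
def Dfw (n B : ℕ) : Matrix (Fin n × Fin B) (Fin n × Fin B) ℝ := Sh n B - 1

/-- THE BACKWARD DIFFERENCE `∂* = Sᵀ − 1 = ∂ᵀ`. OURS (typing). [folklore] -/
def Dbw (n B : ℕ) : Matrix (Fin n × Fin B) (Fin n × Fin B) ℝ := (Sh n B).transpose - 1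

/-- [folklore] -/
theorem Dbw_eq_transpose : Dbw n B = (Dfw n B).transpose := by
  unfold Dbw Dfw; rw [Matrix.transpose_sub, Matrix.transpose_one]

/-- the forward differences of a function `h` on the sites: `θ_h(x) = h(x+1) − h(x)` (`0` at the last site).
OURS (typing). [folklore] -/
def fd (h : Fin n × Fin B → ℝ) (x : Fin n × Fin B) : ℝ := ∑ z, Sh n B x z * (h z - h x)

/-- [folklore] -/
theorem fd_eq {h : Fin n × Fin B → ℝ} {x y : Fin n × Fin B} (hy : ι y = ι x + 1) : fd h x = h y - h x :=
  sum_Sh_mul hy _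

/-- [folklore] -/
theorem fd_eq_zero {h : Fin n × Fin B → ℝ} {x : Fin n × Fin B} (hx : ∀ y : Fin n × Fin B, ι y ≠ ι x + 1) :
    fd h x = 0 :=
  sum_Sh_mul_of_last hx _

/-- the backward-shifted forward differences `θ_h(x − 1)` (`0` at the first site). OURS (typing). [folklore] -/
def bfd (h : Fin n × Fin B → ℝ) (y : Fin n × Fin B) : ℝ := ∑ z, fd h z * Sh n B z y

/-- [folklore] -/
theorem bfd_eq {h : Fin n × Fin B → ℝ} {x y : Fin n × Fin B} (hy : ι y = ι x + 1) : bfd h y = fd h x :=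
  sum_mul_Sh hy _

/-- [folklore] -/
theorem bfd_eq_zero {h : Fin n × Fin B → ℝ} {y : Fin n × Fin B} (hy : ∀ x : Fin n × Fin B, ι y ≠ ι x + 1) :
    bfd h y = 0 :=
  sum_mul_Sh_of_first hy _

/-- the SECOND differences `ξ_h(x) = θ_h(x) − θ_h(x − 1) = h(x+1) − 2h(x) + h(x−1)` (one-sided at the ends).
OURS (typing). [folklore] -/
def sd (h : Fin n × Fin B → ℝ) (x : Fin n × Fin B) : ℝ := fd h x - bfd h x

/-- `Θ_h = diag θ_h`. OURS (typing). [folklore] -/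
def Th (h : Fin n × Fin B → ℝ) : Matrix (Fin n × Fin B) (Fin n × Fin B) ℝ := Matrix.diagonal (fd h)

/-- `Ξ_h = diag ξ_h`. OURS (typing). [folklore] -/
def Xi (h : Fin n × Fin B → ℝ) : Matrix (Fin n × Fin B) (Fin n × Fin B) ℝ := Matrix.diagonal (sd h)

/-- the projection on the last site (no successor). OURS (typing). [folklore] -/
def El (n B : ℕ) : Matrix (Fin n × Fin B) (Fin n × Fin B) ℝ :=
  Matrix.diagonal fun x => if ι x + 1 < n * B then 0 else 1

/-- `S·Sᵀ = 1 − E_last`. [folklore] -/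
theorem Sh_mul_transpose : Sh n B * (Sh n B).transpose = 1 - El n B := by
  ext x y
  rw [Matrix.mul_apply, Matrix.sub_apply, Matrix.one_apply, El, Matrix.diagonal_apply]
  simp only [Matrix.transpose_apply]
  by_cases hx : ι x + 1 < n * B
  · obtain ⟨w, hw⟩ := exists_succ hx
    rw [sum_Sh_mul hw]
    by_cases hxy : x = y
    · subst hxy; rw [if_pos rfl, if_pos rfl, if_pos hx, Sh_apply, if_pos hw]; norm_num
    · rw [if_neg hxy, if_neg hxy, Sh_apply, if_neg, zero_sub]
      · simp
      · intro h; exact hxy (ι_inj.1 (by omega))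
  · have hx' : ∀ y : Fin n × Fin B, ι y ≠ ι x + 1 := fun y h => hx (h ▸ ι_lt y)
    rw [sum_Sh_mul_of_last hx']
    by_cases hxy : x = y
    · subst hxy; rw [if_pos rfl, if_pos rfl, if_neg hx]; norm_num
    · rw [if_neg hxy, if_neg hxy]; norm_num

/-- `θ_h` vanishes at the last site, so `Θ_h·E_last = 0`. [folklore] -/
theorem Th_mul_El (h : Fin n × Fin B → ℝ) : Th h * El n B = 0 := by
  unfold Th El
  rw [Matrix.diagonal_mul_diagonal]
  ext x y
  rw [Matrix.diagonal_apply, Matrix.zero_apply]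
  split_ifs with hxy hx
  · rw [mul_zero]
  · rw [fd_eq_zero (fun y' h' => hx (h' ▸ ι_lt y')), zero_mul]
  · rfl

/-- [folklore] -/
theorem El_mul_Th (h : Fin n × Fin B → ℝ) : El n B * Th h = 0 := by
  have := Th_mul_El (n := n) (B := B) h
  unfold Th El at this ⊢
  rw [Matrix.diagonal_mul_diagonal] at this ⊢
  rw [← this]
  congr 1; ext x; ring

/-- `Sᵀ·Θ_h·S = diag(θ_h(· − 1))`. [folklore] -/
theorem transpose_mul_Th_mul_Sh (h : Fin n × Fin B → ℝ) :
    (Sh n B).transpose * Th h * Sh n B = Matrix.diagonal (bfd h) := by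
  ext x y
  rw [Matrix.mul_apply, Matrix.diagonal_apply]
  unfold Th
  simp only [Matrix.mul_diagonal, Matrix.transpose_apply]
  by_cases hxy : x = y
  · subst hxy
    rw [if_pos rfl, bfd]
    refine sum_congr rfl fun z _ => ?_
    rw [Sh_apply]; split_ifs <;> ring
  · rw [if_neg hxy]
    refine sum_eq_zero fun z _ => ?_
    rw [Sh_apply, Sh_apply]
    split_ifs with h1 h2
    · exact absurd (ι_inj.1 (h1.trans h2.symm)) hxy
    · ring
    · ring
    · ring

/-- `Ξ_h = Θ_h − SᵀΘ_hS`. [folklore] -/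
theorem Xi_eq (h : Fin n × Fin B → ℝ) : Xi h = Th h - (Sh n B).transpose * Th h * Sh n B := by
  rw [transpose_mul_Th_mul_Sh, Xi, Th, Matrix.diagonal_sub]; rfl

variable (h : Fin n × Fin B → ℝ)

/-- **`𝔇(∂) = diag(h)·∂ − ∂·diag(h) = −Θ_h·S`** (exact, every `h`). [folklore] -/
theorem dD_eq : tdef (Matrix.diagonal h) (Matrix.diagonal h) (Dfw n B) (Dfw n B) = -(Th h * Sh n B) := by
  ext x y
  rw [B9SectCDiff.tdef_def, Matrix.sub_apply, Matrix.diagonal_mul, Matrix.mul_diagonal, Matrix.neg_apply, Th,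
    Matrix.diagonal_mul, Dfw, Matrix.sub_apply, Matrix.one_apply, Sh_apply]
  by_cases hy : ι y = ι x + 1
  · have hxy : x ≠ y := fun h' => by rw [h'] at hy; omega
    rw [if_pos hy, if_neg hxy, fd_eq hy]; ring
  · rw [if_neg hy]
    by_cases hxy : x = y
    · subst hxy; simp
    · rw [if_neg hxy]; ring

/-- [folklore] -/
theorem Th_transpose : (Th h).transpose = Th (n := n) (B := B) h := Matrix.diagonal_transpose _

/-- **`𝔇(∂*) = diag(h)·∂* − ∂*·diag(h) = Sᵀ·Θ_h`** (exact, every `h`; the transpose of `dD_eq`). [folklore] -/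
theorem dDt_eq : tdef (Matrix.diagonal h) (Matrix.diagonal h) (Dbw n B) (Dbw n B) = (Sh n B).transpose * Th h := by
  have ht : tdef (Matrix.diagonal h) (Matrix.diagonal h) (Dfw n B).transpose (Dfw n B).transpose =
      -(tdef (Matrix.diagonal h) (Matrix.diagonal h) (Dfw n B) (Dfw n B)).transpose := by
    rw [B9SectCDiff.tdef_def, B9SectCDiff.tdef_def, Matrix.transpose_sub, Matrix.transpose_mul,
      Matrix.transpose_mul, Matrix.diagonal_transpose]
    abel
  rw [Dbw_eq_transpose, ht, dD_eq, Matrix.transpose_neg, neg_neg, Matrix.transpose_mul, Th_transpose]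

/-- `S·𝔇(∂*) = S·Sᵀ·Θ_h = Θ_h`. [folklore] -/
theorem Sh_mul_dDt : Sh n B * ((Sh n B).transpose * Th h) = Th h := by
  rw [← Matrix.mul_assoc, Sh_mul_transpose, sub_mul, one_mul, El_mul_Th, sub_zero]

/-- **THE `hM` SHAPE WITH CONTENT: `∂·𝔇(∂*) = (SᵀΘ_h)·∂ + Ξ_h`** — coefficient operators `Dm₁ = SᵀΘ_h` (first
differences of `h`, order −1) and `Dm₀ = Ξ_h` (second differences, order −2), `Dv = ∂` (exact, every `h`).
[folklore] -/
theorem D_mul_dDt : Dfw n B * tdef (Matrix.diagonal h) (Matrix.diagonal h) (Dbw n B) (Dbw n B) =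
    ((Sh n B).transpose * Th h) * Dfw n B + Xi h := by
  rw [dDt_eq, Xi_eq, Dfw, sub_mul, one_mul, Sh_mul_dDt, mul_sub, mul_one]
  abel

/-- **THE `hΛ` SHAPE WITH CONTENT for `Λ = ∂∂*`: `𝔇(∂∂*) = (Θ_h + SᵀΘ_h)·∂ + Ξ_h`** (exact, every `h`). [folklore] -/
theorem dDDt_eq : tdef (Matrix.diagonal h) (Matrix.diagonal h) (Dfw n B * Dbw n B) (Dfw n B * Dbw n B) =
    (Th h + (Sh n B).transpose * Th h) * Dfw n B + Xi h := by
  rw [B9SectCDiff.tdef_mul (Matrix.diagonal h) (Matrix.diagonal h) (Matrix.diagonal h), D_mul_dDt, dD_eq]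
  have h1 : -(Th h * Sh n B) * Dbw n B = Th h * Dfw n B := by
    rw [Dbw, mul_sub, mul_one, neg_mul, Matrix.mul_assoc, Sh_mul_transpose, mul_sub, mul_one, Th_mul_El, sub_zero,
      Dfw, mul_sub, mul_one]
    abel
  rw [h1, add_mul]
  abel

/-- **THE `hA` SHAPE WITH CONTENT for `Δ′ = ∂*∂ (+ const)`: `𝔇(∂*∂) = (SᵀΘ_h + Θ_h)·∂ + Ξ_h`** (exact, every `h`).
[folklore] -/
theorem dDtD_eq : tdef (Matrix.diagonal h) (Matrix.diagonal h) (Dbw n B * Dfw n B) (Dbw n B * Dfw n B) =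
    (Th h + (Sh n B).transpose * Th h) * Dfw n B + Xi h := by
  rw [B9SectCDiff.tdef_mul (Matrix.diagonal h) (Matrix.diagonal h) (Matrix.diagonal h), dDt_eq, dD_eq, Xi_eq]
  have h1 : Dbw n B * -(Th h * Sh n B) = -((Sh n B).transpose * Th h * Sh n B) + Th h + Th h * Dfw n B := by
    rw [Dbw, sub_mul, one_mul, mul_neg, Dfw, mul_sub, mul_one, Matrix.mul_assoc]
    abel
  rw [h1, add_mul]
  abel

/-- the shift has entries in `{0, 1}`. [folklore] -/
theorem Sh_nonneg (x y : Fin n × Fin B) : 0 ≤ Sh n B x y := by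
  rw [Sh_apply]; split_ifs <;> norm_num

/-- row sums of the shift are `≤ 1`. [folklore] -/
theorem sum_Sh_row_le_one (x : Fin n × Fin B) : ∑ y, Sh n B x y ≤ 1 := by
  rcases em (∃ y : Fin n × Fin B, ι y = ι x + 1) with ⟨y, hy⟩ | hx
  · have h1 := sum_Sh_mul hy (fun _ => (1 : ℝ))
    simp only [mul_one] at h1
    rw [h1]
  · have hx' : ∀ y : Fin n × Fin B, ι y ≠ ι x + 1 := fun y hy => hx ⟨y, hy⟩
    have h1 := sum_Sh_mul_of_last hx' (fun _ => (1 : ℝ))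
    simp only [mul_one] at h1
    rw [h1]; norm_num

/-- column sums of the shift are `≤ 1`. [folklore] -/
theorem sum_Sh_col_le_one (y : Fin n × Fin B) : ∑ x, Sh n B x y ≤ 1 := by
  rcases em (∃ x : Fin n × Fin B, ι y = ι x + 1) with ⟨x, hx⟩ | hy
  · have h1 := sum_mul_Sh hx (fun _ => (1 : ℝ))
    simp only [one_mul] at h1
    rw [h1]
  · have hy' : ∀ x : Fin n × Fin B, ι y ≠ ι x + 1 := fun x hx => hy ⟨x, hx⟩
    have h1 := sum_mul_Sh_of_first hy' (fun _ => (1 : ℝ))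
    simp only [one_mul] at h1
    rw [h1]; norm_num

/-- [folklore] -/
theorem sum_abs_one_row (x : Fin n × Fin B) : ∑ y, |(1 : Matrix (Fin n × Fin B) (Fin n × Fin B) ℝ) x y| = 1 := by
  have h : ∀ y, |(1 : Matrix (Fin n × Fin B) (Fin n × Fin B) ℝ) x y| = if x = y then 1 else 0 := fun y => by
    rw [Matrix.one_apply]; split_ifs <;> simp
  simp_rw [h]
  rw [Finset.sum_ite_eq, if_pos (mem_univ _)]

/-- `∂` has entries only at distance `≤ 1` … [folklore] -/
theorem dE_le_one_of_Dfw_ne_zero {x y : Fin n × Fin B} (h : Dfw n B x y ≠ 0) : dE n B x y ≤ 1 := by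
  rw [Dfw, Matrix.sub_apply, Sh_apply, Matrix.one_apply] at h
  by_cases hy : ι y = ι x + 1
  · exact (dE_of_succ hy).1.le
  · by_cases hxy : x = y
    · subst hxy; rw [dE_self]; norm_num
    · rw [if_neg hy, if_neg hxy, sub_zero] at h; exact absurd rfl h

/-- … and so has `∂*`. [folklore] -/
theorem dE_le_one_of_Dbw_ne_zero {x y : Fin n × Fin B} (h : Dbw n B x y ≠ 0) : dE n B x y ≤ 1 := by
  rw [Dbw_eq_transpose, Matrix.transpose_apply] at h
  rw [dE_comm]; exact dE_le_one_of_Dfw_ne_zero h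

/-- `∂` has absolute row sums `≤ 2`. [folklore] -/
theorem sum_abs_Dfw_le (x : Fin n × Fin B) : ∑ y, |Dfw n B x y| ≤ 2 := by
  calc ∑ y, |Dfw n B x y| = ∑ y, |Sh n B x y - (1 : Matrix _ _ ℝ) x y| := by rfl
    _ ≤ ∑ y, (|Sh n B x y| + |(1 : Matrix _ _ ℝ) x y|) := sum_le_sum fun y _ => abs_sub _ _
    _ = ∑ y, Sh n B x y + 1 := by
        rw [sum_add_distrib, sum_abs_one_row]
        congr 1
        exact sum_congr rfl fun y _ => abs_of_nonneg (Sh_nonneg x y)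
    _ ≤ 1 + 1 := by linarith [sum_Sh_row_le_one (n := n) (B := B) x]
    _ = 2 := by norm_num

/-- `∂*` has absolute row sums `≤ 2`. [folklore] -/
theorem sum_abs_Dbw_le (x : Fin n × Fin B) : ∑ y, |Dbw n B x y| ≤ 2 := by
  calc ∑ y, |Dbw n B x y| = ∑ y, |Sh n B y x - (1 : Matrix _ _ ℝ) x y| := by
        refine sum_congr rfl fun y _ => ?_
        rw [Dbw, Matrix.sub_apply, Matrix.transpose_apply]
    _ ≤ ∑ y, (|Sh n B y x| + |(1 : Matrix _ _ ℝ) x y|) := sum_le_sum fun y _ => abs_sub _ _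
    _ = ∑ y, Sh n B y x + 1 := by
        rw [sum_add_distrib, sum_abs_one_row]
        congr 1
        exact sum_congr rfl fun y _ => abs_of_nonneg (Sh_nonneg y x)
    _ ≤ 1 + 1 := by linarith [sum_Sh_col_le_one (n := n) (B := B) x]
    _ = 2 := by norm_num

end Ops

/-! ## §3 The h-free records of `∂`, `∂*` in the block frame (range 1 on the unit scale, radius `≤ B`, block row
sums `≤ 2e^{δ₀}·e^{−δ₀|I−J|}` — non-zero constants `o = ⟨1, 0, 2e^{δ₀}⟩`) -/

section Records

variable {n B : ℕ} {N : Finset (Fin n)} {hN : N.Nonempty} {δ₀ : ℝ}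

/-- sites at distance `≤ B` lie in the same or in adjacent blocks. [folklore] -/
theorem bdist_le_one_of_dE_le {x y : Fin n × Fin B} (h : dE n B x y ≤ B) : bdist n x.1 y.1 ≤ 1 := by
  rw [dE_eq_ι] at h
  have h' := abs_le.1 h
  have h1 : ι y ≤ ι x + B := by
    have : (ι y : ℝ) ≤ ι x + B := by linarith [h'.1]
    exact_mod_cast this
  have h2 : ι x ≤ ι y + B := by
    have : (ι x : ℝ) ≤ ι y + B := by linarith [h'.2]
    exact_mod_cast this
  have h3 : (y.1.val : ℝ) ≤ x.1.val + 1 := by exact_mod_cast fst_le_succ_of_ι_le h1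
  have h4 : (x.1.val : ℝ) ≤ y.1.val + 1 := by exact_mod_cast fst_le_succ_of_ι_le h2
  unfold bdist
  rw [abs_le]; constructor <;> linarith

/-- **THE h-FREE RECORD OF A NEAREST-NEIGHBOUR OPERATOR** on the block line: entries only at distance `≤ 1` and
absolute row sums `≤ 2` give `OpLoc … (−1) ⟨1, 0, 2e^{δ₀}⟩`: range `1 = 1·B⁰` (scale exponent `κ = 0`), radius
`1 ≤ B`, and block row sums `≤ 2 ≤ 2e^{δ₀}·B^{(−1)+1−0}·e^{−δ₀|I−J|}` (only blocks at distance `≤ 1` are charged).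
NON-ZERO constants: this is the record of an operator of order `k = −1` with CONTENT. [folklore] -/
theorem opLoc_nn (hB : 0 < B) (hδ₀ : 0 ≤ δ₀) {T : Matrix (Fin n × Fin B) (Fin n × Fin B) ℝ}
    (h1 : ∀ x y, T x y ≠ 0 → dE n B x y ≤ 1) (h2 : ∀ x, ∑ y, |T x y| ≤ 2) :
    OpLoc (lineFrame n B N hN δ₀) id id (dE n B) (fun _ => (B : ℝ)) (-1) ⟨1, 0, 2 * Real.exp δ₀⟩ T id id id
      Prod.fst Prod.fst where
  r_nonneg := zero_le_one
  c_nonneg := by show (0 : ℝ) ≤ 2 * Real.exp δ₀; positivity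
  rng a y _ hT := by
    show dE n B a y ≤ 1 * (B : ℝ) ^ (0 : ℤ)
    rw [zpow_zero, one_mul]; exact h1 a y hT
  loc a y hT := by
    show dE n B a y ≤ (B : ℝ)
    have hB1 : (1 : ℝ) ≤ B := by exact_mod_cast hB
    exact (h1 a y hT).trans hB1
  maj a J _ := by
    show ∑ y ∈ univ.filter (fun y : Fin n × Fin B => y.1 = J), |T (id a) y| ≤
      2 * Real.exp δ₀ * (B : ℝ) ^ ((-1 : ℤ) + 1 - 0) * Real.exp (-(δ₀ * bdist n (id (Prod.fst a)) (id J)))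
    rw [show ((-1 : ℤ) + 1 - 0) = 0 by norm_num, zpow_zero, mul_one]
    simp only [id]
    by_cases hJ : ∃ y : Fin n × Fin B, y.1 = J ∧ T a y ≠ 0
    · obtain ⟨y, hy, hT⟩ := hJ
      have hB1 : (1 : ℝ) ≤ B := by exact_mod_cast hB
      have hd : bdist n a.1 J ≤ 1 := by rw [← hy]; exact bdist_le_one_of_dE_le ((h1 a y hT).trans hB1)
      have hdd : δ₀ * bdist n a.1 J ≤ δ₀ := by
        have := mul_le_mul_of_nonneg_left hd hδ₀; linarith
      calc ∑ y ∈ univ.filter (fun y : Fin n × Fin B => y.1 = J), |T a y| ≤ ∑ y, |T a y| :=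
            sum_le_sum_of_subset_of_nonneg (filter_subset _ _) fun _ _ _ => abs_nonneg _
        _ ≤ 2 := h2 a
        _ = 2 * Real.exp δ₀ * Real.exp (-δ₀) := by rw [mul_assoc, ← Real.exp_add, add_neg_cancel, Real.exp_zero, mul_one]
        _ ≤ 2 * Real.exp δ₀ * Real.exp (-(δ₀ * bdist n a.1 J)) :=
            mul_le_mul_of_nonneg_left (Real.exp_le_exp.2 (by linarith)) (by positivity)
    · have hJ' : ∀ y : Fin n × Fin B, y.1 = J → T a y = 0 := fun y hy => by
        by_contra hT; exact hJ ⟨y, hy, hT⟩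
      rw [sum_eq_zero fun y hy => by rw [hJ' y (mem_filter.1 hy).2, abs_zero]]
      positivity

/-- **THE h-FREE RECORD OF `∂`** (the `CutModel.lD` shape with `D := ∂ ≠ 0`): `OpLoc … (−1) ⟨1, 0, 2e^{δ₀}⟩ ∂`.
OURS. [cite: Balaban1985BackgroundPropagators, (3.100) p.413] -/
theorem opLoc_Dfw (hB : 0 < B) (hδ₀ : 0 ≤ δ₀) :
    OpLoc (lineFrame n B N hN δ₀) id id (dE n B) (fun _ => (B : ℝ)) (-1) ⟨1, 0, 2 * Real.exp δ₀⟩ (Dfw n B) id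
      id id Prod.fst Prod.fst :=
  opLoc_nn hB hδ₀ (fun _ _ => dE_le_one_of_Dfw_ne_zero) sum_abs_Dfw_le

/-- **THE h-FREE RECORD OF `∂*`** (the `CutModel.lDt` shape with `D* := ∂* ≠ 0`). OURS.
[cite: Balaban1985BackgroundPropagators, (3.100) p.413] -/
theorem opLoc_Dbw (hB : 0 < B) (hδ₀ : 0 ≤ δ₀) :
    OpLoc (lineFrame n B N hN δ₀) id id (dE n B) (fun _ => (B : ℝ)) (-1) ⟨1, 0, 2 * Real.exp δ₀⟩ (Dbw n B) id
      id id Prod.fst Prod.fst :=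
  opLoc_nn hB hδ₀ (fun _ _ => dE_le_one_of_Dbw_ne_zero) sum_abs_Dbw_le

/-- **COLUMN-BLOCK REFINEMENT of an h-free record**: a record for column blocks `bc` is one for any FINER column
blocks `bc′` (`g ∘ bc′ = bc`) read at the same frame sites (`p₂′ = p₂ ∘ g`) — the block row sums only shrink.
[folklore] -/
theorem opLoc_refine {S U₁ U₂ U₂' E u v mu : Type*} [Fintype v] [DecidableEq U₂] [DecidableEq U₂'] {F : Frame S}
    {p₁ : U₁ → S} {p₂ : U₂ → S} {dE : E → E → ℝ} {ℓ : E → ℝ} {k : ℤ} {o : OpConst} {T : Matrix u v ℝ}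
    {f : mu → u} {xr : mu → E} {xc : v → E} {br : mu → U₁} {bc : v → U₂}
    (h : OpLoc F p₁ p₂ dE ℓ k o T f xr xc br bc) (bc' : v → U₂') (g : U₂' → U₂) (p₂' : U₂' → S)
    (hg : ∀ y, g (bc' y) = bc y) (hp : ∀ J', p₂' J' = p₂ (g J')) : OpLoc F p₁ p₂' dE ℓ k o T f xr xc br bc' where
  r_nonneg := h.r_nonneg
  c_nonneg := h.c_nonneg
  rng := h.rng
  loc := h.loc
  maj a J' hβ := by
    rw [hp]
    refine le_trans (sum_le_sum_of_subset_of_nonneg (fun y hy => ?_) fun _ _ _ => abs_nonneg _) (h.maj a (g J') hβ)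
    rw [mem_filter] at hy ⊢
    exact ⟨hy.1, by rw [← hy.2, hg]⟩

/-- [folklore] -/
theorem p2_bs2 {I₀ : ℕ} (y : Fin n × Fin B) : p2 n B I₀ (bs2 n B I₀ y) = y.1 := by
  unfold bs2; split_ifs <;> rfl

/-- the record of `∂` with the sequence-2 column blocks of gen 15 (`bs2`: window blocks ⊕ left sites). OURS.
[cite: Balaban1985BackgroundPropagators, (3.100) p.413] -/
theorem opLoc_Dfw₂ (hB : 0 < B) (hδ₀ : 0 ≤ δ₀) {I₀ : ℕ} :
    OpLoc (lineFrame n B N hN δ₀) id (p2 n B I₀) (dE n B) (fun _ => (B : ℝ)) (-1) ⟨1, 0, 2 * Real.exp δ₀⟩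
      (Dfw n B) id id id Prod.fst (bs2 n B I₀) :=
  opLoc_refine (opLoc_Dfw hB hδ₀) (bs2 n B I₀) (p2 n B I₀) (p2 n B I₀) p2_bs2 fun _ => rfl

end Records

/-! ## §4 The zone classes of the coefficient operators `Θ_h, SᵀΘ_h, Ξ_h` and of the defects `𝔇(∂), 𝔇(∂*)` -/

section Classes

variable {n B : ℕ} {N : Finset (Fin n)} {hN : N.Nonempty} {δ₀ : ℝ}
variable {U V : Type*} [DecidableEq V] {bu : Fin n × Fin B → U} {bv : Fin n × Fin B → V} {pU : U → Fin n}
  {pV : V → Fin n}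

/-- **LOCAL-OPERATOR ENGINE on the toy frame**: at most one non-zero entry per row, at block distance `≤ R`, of
size `≤ θ₁·Bᵏ`, on zone rows ⇒ `𝒵(k, θ₁e^{δ₀R})` for ANY block maps over the block projection. [folklore] -/
theorem opZon_local_toy (hB : 0 < B) (hδ₀ : 0 < δ₀) {T : Matrix (Fin n × Fin B) (Fin n × Fin B) ℝ} {k : ℤ}
    {θ₁ R : ℝ} (hθ : 0 ≤ θ₁) (hbu : ∀ x, pU (bu x) = x.1) (hbv : ∀ x, pV (bv x) = x.1)
    (hcard : ∀ x, (univ.filter fun x' => T x x' ≠ 0).card ≤ 1)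
    (hR : ∀ x x', T x x' ≠ 0 → bdist n x.1 x'.1 ≤ R) (hsup : ∀ x x', |T x x'| ≤ θ₁ * (B : ℝ) ^ k)
    (hz : ∀ x x', T x x' ≠ 0 → (toyFrame n B N hN δ₀).β x.1 = 0) :
    OpZon (toyFrame n B N hN δ₀) bu bv pU pV k (θ₁ * Real.exp (δ₀ * R)) T := by
  have hF := toyFrame_valid hB hN hδ₀
  rw [show θ₁ * Real.exp (δ₀ * R) = ((1 : ℕ) : ℝ) * (θ₁ * Real.exp (δ₀ * R)) by rw [Nat.cast_one, one_mul]]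
  refine B9SectCDiffDict.opZon_of_local hF (by positivity) hcard (fun x x' hT => ?_) (fun x x' hT => ?_)
  · simp only [toyFrame_sc, toyFrame_δ₀, toyFrame_ρ, hbu, hbv]
    have h2 : δ₀ * bdist n x.1 x'.1 ≤ δ₀ * R := mul_le_mul_of_nonneg_left (hR x x' hT) hδ₀.le
    have h3 : (1 : ℝ) ≤ Real.exp (δ₀ * R) * Real.exp (-(δ₀ * bdist n x.1 x'.1)) := by
      rw [← Real.exp_add]; exact Real.one_le_exp (by linarith)
    have hBk : (0 : ℝ) ≤ (B : ℝ) ^ k := zpow_nonneg (Nat.cast_nonneg B) k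
    calc |T x x'| ≤ θ₁ * (B : ℝ) ^ k * 1 := by rw [mul_one]; exact hsup x x'
      _ ≤ θ₁ * (B : ℝ) ^ k * (Real.exp (δ₀ * R) * Real.exp (-(δ₀ * bdist n x.1 x'.1))) :=
          mul_le_mul_of_nonneg_left h3 (mul_nonneg hθ hBk)
      _ = θ₁ * Real.exp (δ₀ * R) * (B : ℝ) ^ k * Real.exp (-(δ₀ * bdist n x.1 x'.1)) := by ring
  · rw [hbu]; exact hz x x' hT

variable {h : Fin n × Fin B → ℝ} {ω₀ ω₁ : ℝ}

/-- nearest-neighbour modulus from the `CutModel.modulus` shape (radius `B ≥ 1 =` the neighbour distance).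
[folklore] -/
theorem nn_mod (hB : 0 < B)
    (hmod : ∀ e e', dE n B e e' ≤ (fun _ => (B : ℝ)) e →
      |h e - h e'| ≤ ω₀ * ((toyFrame n B N hN δ₀).sc (id (Prod.fst e)))⁻¹ * dE n B e e')
    {x y : Fin n × Fin B} (hy : ι y = ι x + 1) : |h y - h x| ≤ ω₀ * (B : ℝ)⁻¹ := by
  have hB1 : (1 : ℝ) ≤ B := by exact_mod_cast hB
  have h1 := hmod y x (by rw [(dE_of_succ hy).2]; exact hB1)
  rw [(dE_of_succ hy).2, mul_one] at h1
  exact h1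

/-- nearest-neighbour zone location from the `CutModel.zone` shape. [folklore] -/
theorem nn_zone (hB : 0 < B)
    (hzone : ∀ e e', dE n B e e' ≤ (fun _ => (B : ℝ)) e → h e ≠ h e' →
      (toyFrame n B N hN δ₀).β (id (Prod.fst e)) = 0)
    {x y : Fin n × Fin B} (hy : ι y = ι x + 1) (hne : h y ≠ h x) :
    (toyFrame n B N hN δ₀).β x.1 = 0 ∧ (toyFrame n B N hN δ₀).β y.1 = 0 := by
  have hB1 : (1 : ℝ) ≤ B := by exact_mod_cast hB
  exact ⟨hzone x y (by rw [(dE_of_succ hy).1]; exact hB1) hne.symm,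
    hzone y x (by rw [(dE_of_succ hy).2]; exact hB1) hne⟩

/-- `|θ_h(x)| ≤ ω₀B⁻¹`. [folklore] -/
theorem abs_fd_le (hB : 0 < B) (hω₀ : 0 ≤ ω₀)
    (hmod : ∀ e e', dE n B e e' ≤ (fun _ => (B : ℝ)) e →
      |h e - h e'| ≤ ω₀ * ((toyFrame n B N hN δ₀).sc (id (Prod.fst e)))⁻¹ * dE n B e e')
    (x : Fin n × Fin B) : |fd h x| ≤ ω₀ * (B : ℝ)⁻¹ := by
  rcases em (∃ y : Fin n × Fin B, ι y = ι x + 1) with ⟨y, hy⟩ | hx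
  · rw [fd_eq hy]; exact nn_mod hB hmod hy
  · rw [fd_eq_zero fun y hy => hx ⟨y, hy⟩, abs_zero]; positivity

/-- `θ_h(x) ≠ 0 ⇒` the block of `x` is a zone block. [folklore] -/
theorem zone_of_fd_ne_zero (hB : 0 < B)
    (hzone : ∀ e e', dE n B e e' ≤ (fun _ => (B : ℝ)) e → h e ≠ h e' →
      (toyFrame n B N hN δ₀).β (id (Prod.fst e)) = 0)
    {x : Fin n × Fin B} (hx : fd h x ≠ 0) : (toyFrame n B N hN δ₀).β x.1 = 0 := by
  rcases em (∃ y : Fin n × Fin B, ι y = ι x + 1) with ⟨y, hy⟩ | hx'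
  · rw [fd_eq hy] at hx
    exact (nn_zone hB hzone hy (sub_ne_zero.1 hx)).1
  · exact absurd (fd_eq_zero fun y hy => hx' ⟨y, hy⟩) hx

/-- `θ_h(x − 1) ≠ 0 ⇒` the block of `x` is a zone block. [folklore] -/
theorem zone_of_bfd_ne_zero (hB : 0 < B)
    (hzone : ∀ e e', dE n B e e' ≤ (fun _ => (B : ℝ)) e → h e ≠ h e' →
      (toyFrame n B N hN δ₀).β (id (Prod.fst e)) = 0)
    {y : Fin n × Fin B} (hy : bfd h y ≠ 0) : (toyFrame n B N hN δ₀).β y.1 = 0 := by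
  rcases em (∃ x : Fin n × Fin B, ι y = ι x + 1) with ⟨x, hx⟩ | hy'
  · rw [bfd_eq hx, fd_eq hx] at hy
    exact (nn_zone hB hzone hx (sub_ne_zero.1 hy)).2
  · exact absurd (bfd_eq_zero fun x hx => hy' ⟨x, hx⟩) hy

/-- **`Θ_h ∈ 𝒵(−1, ω₀)`**: the diagonal of first differences of a cutoff with proper-scale modulus `ω₀` is a
zone-class coefficient operator of order `−1` and size `ω₀` (*"O(M⁻¹) … on a proper scale"*, p. 414, for
`ω₀ = O(M⁻¹)`). OURS. [cite: Balaban1985BackgroundPropagators, p.414 + (3.100) p.413] -/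
theorem opZon_Th (hB : 0 < B) (hδ₀ : 0 < δ₀) (hω₀ : 0 ≤ ω₀) (hbu : ∀ x, pU (bu x) = x.1)
    (hbv : ∀ x, pV (bv x) = x.1)
    (hmod : ∀ e e', dE n B e e' ≤ (fun _ => (B : ℝ)) e →
      |h e - h e'| ≤ ω₀ * ((toyFrame n B N hN δ₀).sc (id (Prod.fst e)))⁻¹ * dE n B e e')
    (hzone : ∀ e e', dE n B e e' ≤ (fun _ => (B : ℝ)) e → h e ≠ h e' →
      (toyFrame n B N hN δ₀).β (id (Prod.fst e)) = 0) :
    OpZon (toyFrame n B N hN δ₀) bu bv pU pV (-1) ω₀ (Th h) := by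
  rw [show ω₀ = ω₀ * Real.exp (δ₀ * 0) by rw [mul_zero, Real.exp_zero, mul_one]]
  refine opZon_local_toy hB hδ₀ hω₀ hbu hbv (fun x => ?_) (fun x x' hT => ?_) (fun x x' => ?_) (fun x x' hT => ?_)
  · refine card_le_one.2 fun a ha b hb => ?_
    rw [mem_filter] at ha hb
    have ha' : x = a := by by_contra hne; exact ha.2 (Matrix.diagonal_apply_ne _ hne)
    have hb' : x = b := by by_contra hne; exact hb.2 (Matrix.diagonal_apply_ne _ hne)
    rw [← ha', ← hb']
  · have : x = x' := by by_contra hne; exact hT (Matrix.diagonal_apply_ne _ hne)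
    rw [this, bdist_self]
  · rw [Th, zpow_neg_one]
    by_cases hxx : x = x'
    · subst hxx; rw [Matrix.diagonal_apply_eq]; exact abs_fd_le hB hω₀ hmod x
    · rw [Matrix.diagonal_apply_ne _ hxx, abs_zero]; positivity
  · have : x = x' := by by_contra hne; exact hT (Matrix.diagonal_apply_ne _ hne)
    subst this
    rw [Th, Matrix.diagonal_apply_eq] at hT
    exact zone_of_fd_ne_zero hB hzone hT

/-- [folklore] -/
theorem transpose_mul_Th_apply (x x' : Fin n × Fin B) :
    ((Sh n B).transpose * Th h) x x' = Sh n B x' x * fd h x' := by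
  rw [Th, Matrix.mul_diagonal, Matrix.transpose_apply]

/-- **`SᵀΘ_h ∈ 𝒵(−1, ω₀e^{δ₀})`** (the sub-diagonal of first differences; the factor `e^{δ₀}` pays for the one
entry per block boundary that sits in the adjacent block). OURS.
[cite: Balaban1985BackgroundPropagators, p.414 + (3.100) p.413] -/
theorem opZon_transpose_mul_Th (hB : 0 < B) (hδ₀ : 0 < δ₀) (hω₀ : 0 ≤ ω₀) (hbu : ∀ x, pU (bu x) = x.1)
    (hbv : ∀ x, pV (bv x) = x.1)
    (hmod : ∀ e e', dE n B e e' ≤ (fun _ => (B : ℝ)) e →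
      |h e - h e'| ≤ ω₀ * ((toyFrame n B N hN δ₀).sc (id (Prod.fst e)))⁻¹ * dE n B e e')
    (hzone : ∀ e e', dE n B e e' ≤ (fun _ => (B : ℝ)) e → h e ≠ h e' →
      (toyFrame n B N hN δ₀).β (id (Prod.fst e)) = 0) :
    OpZon (toyFrame n B N hN δ₀) bu bv pU pV (-1) (ω₀ * Real.exp δ₀) ((Sh n B).transpose * Th h) := by
  rw [show ω₀ * Real.exp δ₀ = ω₀ * Real.exp (δ₀ * 1) by rw [mul_one]]
  have hnz : ∀ x x', ((Sh n B).transpose * Th h) x x' ≠ 0 → ι x = ι x' + 1 ∧ fd h x' ≠ 0 := by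
    intro x x' hT
    rw [transpose_mul_Th_apply, Sh_apply] at hT
    by_cases h1 : ι x = ι x' + 1
    · rw [if_pos h1, one_mul] at hT; exact ⟨h1, hT⟩
    · rw [if_neg h1, zero_mul] at hT; exact absurd rfl hT
  refine opZon_local_toy hB hδ₀ hω₀ hbu hbv (fun x => ?_) (fun x x' hT => ?_) (fun x x' => ?_) (fun x x' hT => ?_)
  · refine card_le_one.2 fun a ha b hb => ?_
    rw [mem_filter] at ha hb
    exact ι_inj.1 (by have := (hnz x a ha.2).1; have := (hnz x b hb.2).1; omega)
  · rw [(bdist_isPseudoDist n).symm]; exact bdist_le_one_of_succ (hnz x x' hT).1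
  · rw [transpose_mul_Th_apply, Sh_apply, zpow_neg_one]
    by_cases h1 : ι x = ι x' + 1
    · rw [if_pos h1, one_mul]; exact abs_fd_le hB hω₀ hmod x'
    · rw [if_neg h1, zero_mul, abs_zero]; positivity
  · obtain ⟨h1, h2⟩ := hnz x x' hT
    rw [fd_eq h1] at h2
    exact (nn_zone hB hzone h1 (sub_ne_zero.1 h2)).2

/-- **`Ξ_h ∈ 𝒵(−2, ω₁)`** GIVEN a proper-scale bound `|ξ_h| ≤ ω₁B⁻²` on the SECOND differences of the cutoff (the
*"O(M⁻²) … on a proper scale"* clause of p. 414 is a hypothesis on `h` beyond `CutModel.modulus`: see §5 for a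
cutoff that has it and the census note for the piecewise-linear ramp, which has it only with `ω₁ = B/M`). OURS.
[cite: Balaban1985BackgroundPropagators, p.414 + (3.100) p.413] -/
theorem opZon_Xi (hB : 0 < B) (hδ₀ : 0 < δ₀) (hω₁ : 0 ≤ ω₁) (hbu : ∀ x, pU (bu x) = x.1)
    (hbv : ∀ x, pV (bv x) = x.1)
    (hzone : ∀ e e', dE n B e e' ≤ (fun _ => (B : ℝ)) e → h e ≠ h e' →
      (toyFrame n B N hN δ₀).β (id (Prod.fst e)) = 0)
    (hξ : ∀ x, |sd h x| ≤ ω₁ * ((B : ℝ) ^ 2)⁻¹) :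
    OpZon (toyFrame n B N hN δ₀) bu bv pU pV (-2) ω₁ (Xi h) := by
  rw [show ω₁ = ω₁ * Real.exp (δ₀ * 0) by rw [mul_zero, Real.exp_zero, mul_one]]
  refine opZon_local_toy hB hδ₀ hω₁ hbu hbv (fun x => ?_) (fun x x' hT => ?_) (fun x x' => ?_) (fun x x' hT => ?_)
  · refine card_le_one.2 fun a ha b hb => ?_
    rw [mem_filter] at ha hb
    have ha' : x = a := by by_contra hne; exact ha.2 (Matrix.diagonal_apply_ne _ hne)
    have hb' : x = b := by by_contra hne; exact hb.2 (Matrix.diagonal_apply_ne _ hne)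
    rw [← ha', ← hb']
  · have : x = x' := by by_contra hne; exact hT (Matrix.diagonal_apply_ne _ hne)
    rw [this, bdist_self]
  · rw [Xi, show ((-2 : ℤ)) = -((2 : ℕ) : ℤ) by norm_num, zpow_neg, zpow_natCast]
    by_cases hxx : x = x'
    · subst hxx; rw [Matrix.diagonal_apply_eq]; exact hξ x
    · rw [Matrix.diagonal_apply_ne _ hxx, abs_zero]; positivity
  · have : x = x' := by by_contra hne; exact hT (Matrix.diagonal_apply_ne _ hne)
    subst this
    rw [Xi, Matrix.diagonal_apply_eq, sd] at hT
    by_cases h1 : fd h x = 0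
    · rw [h1, zero_sub, neg_ne_zero] at hT; exact zone_of_bfd_ne_zero hB hzone hT
    · exact zone_of_fd_ne_zero hB hzone h1

/-- **THE FIRST-ORDER COEFFICIENT `Θ_h + SᵀΘ_h ∈ 𝒵(−1, ω₀(1 + e^{δ₀}))`** (the `zLm₁` / `zAm₁` content for
`Λ = ∂∂*`, `Δ′ = ∂*∂`). OURS. [cite: Balaban1985BackgroundPropagators, p.414 + (3.100) p.413] -/
theorem opZon_Lm₁ (hB : 0 < B) (hδ₀ : 0 < δ₀) (hω₀ : 0 ≤ ω₀) (hbu : ∀ x, pU (bu x) = x.1)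
    (hbv : ∀ x, pV (bv x) = x.1)
    (hmod : ∀ e e', dE n B e e' ≤ (fun _ => (B : ℝ)) e →
      |h e - h e'| ≤ ω₀ * ((toyFrame n B N hN δ₀).sc (id (Prod.fst e)))⁻¹ * dE n B e e')
    (hzone : ∀ e e', dE n B e e' ≤ (fun _ => (B : ℝ)) e → h e ≠ h e' →
      (toyFrame n B N hN δ₀).β (id (Prod.fst e)) = 0) :
    OpZon (toyFrame n B N hN δ₀) bu bv pU pV (-1) (ω₀ * (1 + Real.exp δ₀)) (Th h + (Sh n B).transpose * Th h) := by
  rw [show ω₀ * (1 + Real.exp δ₀) = ω₀ + ω₀ * Real.exp δ₀ by ring]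
  exact B9SectCDiffDict.opZon_add (opZon_Th hB hδ₀ hω₀ hbu hbv hmod hzone)
    (opZon_transpose_mul_Th hB hδ₀ hω₀ hbu hbv hmod hzone)

/-- **`𝔇(∂) ∈ 𝒵(−1, 2ω₀e^{δ₀})` BY THE GEOMETRIC ZONE DICTIONARY** from the h-free record `opLoc_Dfw` and the two
cutoff facts in the `CutModel` shapes (the `toLDat.zD` route of gen 13, now with `D ≠ 0`). OURS.
[cite: Balaban1985BackgroundPropagators, (3.102) p.414 + (3.100) p.413] -/
theorem dD_opZon (hB : 0 < B) (hδ₀ : 0 < δ₀) (hω₀ : 0 ≤ ω₀)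
    (hmod : ∀ e e', dE n B e e' ≤ (fun _ => (B : ℝ)) e →
      |h e - h e'| ≤ ω₀ * ((toyFrame n B N hN δ₀).sc (id (Prod.fst e)))⁻¹ * dE n B e e')
    (hzone : ∀ e e', dE n B e e' ≤ (fun _ => (B : ℝ)) e → h e ≠ h e' →
      (toyFrame n B N hN δ₀).β (id (Prod.fst e)) = 0) :
    OpZon (toyFrame n B N hN δ₀) Prod.fst Prod.fst id id (-1) (ω₀ * 1 * (2 * Real.exp δ₀))
      (tdef (cutX id id h) (cutX id id h) (Dfw n B) (Dfw n B)) :=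
  opZon_of_geom (F := toyFrame n B N hN δ₀) (bu := Prod.fst) (bv := Prod.fst) (p₁ := id) (p₂ := id)
    (T₁ := Dfw n B) (T₂ := Dfw n B) (f₁ := id) (f₂ := id) (e₁ := id) (e₂ := id) (ψ := h) (χ := h) (h := h)
    (blk := Prod.fst) (xr := id) (xc := id) (br := Prod.fst) (o := ⟨1, 0, 2 * Real.exp δ₀⟩)
    (toyFrame_valid hB hN hδ₀) Function.injective_id Function.injective_id (fun _ => rfl) (fun _ => rfl)
    (fun _ => rfl) (fun _ => rfl) hmod hω₀ hzone (opLoc_toy (opLoc_Dfw hB hδ₀.le)) (fun _ _ _ => rfl)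
    (fun _ t ht => absurd ⟨t, rfl⟩ ht) (fun s _ hs => absurd ⟨s, rfl⟩ hs)

/-- **`𝔇(∂*) ∈ 𝒵(−1, 2ω₀e^{δ₀})`** likewise from `opLoc_Dbw`. OURS.
[cite: Balaban1985BackgroundPropagators, (3.102) p.414 + (3.100) p.413] -/
theorem dDt_opZon (hB : 0 < B) (hδ₀ : 0 < δ₀) (hω₀ : 0 ≤ ω₀)
    (hmod : ∀ e e', dE n B e e' ≤ (fun _ => (B : ℝ)) e →
      |h e - h e'| ≤ ω₀ * ((toyFrame n B N hN δ₀).sc (id (Prod.fst e)))⁻¹ * dE n B e e')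
    (hzone : ∀ e e', dE n B e e' ≤ (fun _ => (B : ℝ)) e → h e ≠ h e' →
      (toyFrame n B N hN δ₀).β (id (Prod.fst e)) = 0) :
    OpZon (toyFrame n B N hN δ₀) Prod.fst Prod.fst id id (-1) (ω₀ * 1 * (2 * Real.exp δ₀))
      (tdef (cutX id id h) (cutX id id h) (Dbw n B) (Dbw n B)) :=
  opZon_of_geom (F := toyFrame n B N hN δ₀) (bu := Prod.fst) (bv := Prod.fst) (p₁ := id) (p₂ := id)
    (T₁ := Dbw n B) (T₂ := Dbw n B) (f₁ := id) (f₂ := id) (e₁ := id) (e₂ := id) (ψ := h) (χ := h) (h := h)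
    (blk := Prod.fst) (xr := id) (xc := id) (br := Prod.fst) (o := ⟨1, 0, 2 * Real.exp δ₀⟩)
    (toyFrame_valid hB hN hδ₀) Function.injective_id Function.injective_id (fun _ => rfl) (fun _ => rfl)
    (fun _ => rfl) (fun _ => rfl) hmod hω₀ hzone (opLoc_toy (opLoc_Dbw hB hδ₀.le)) (fun _ _ _ => rfl)
    (fun _ t ht => absurd ⟨t, rfl⟩ ht) (fun s _ hs => absurd ⟨s, rfl⟩ hs)

/-- the same in the diagonal presentation: `diag(h)·∂ − ∂·diag(h) ∈ 𝒵(−1, 2ω₀e^{δ₀})` — and by `dD_eq` this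
operator IS `−Θ_h·S`, whose direct class `𝒵(−1, ω₀e^{δ₀})` (one entry per row) the geometric dictionary recovers
up to the factor `2` of the record's row-sum constant. OURS. [cite: Balaban1985BackgroundPropagators, (3.102) p.414] -/
theorem dD_opZon_diag (hB : 0 < B) (hδ₀ : 0 < δ₀) (hω₀ : 0 ≤ ω₀)
    (hmod : ∀ e e', dE n B e e' ≤ (fun _ => (B : ℝ)) e →
      |h e - h e'| ≤ ω₀ * ((toyFrame n B N hN δ₀).sc (id (Prod.fst e)))⁻¹ * dE n B e e')
    (hzone : ∀ e e', dE n B e e' ≤ (fun _ => (B : ℝ)) e → h e ≠ h e' →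
      (toyFrame n B N hN δ₀).β (id (Prod.fst e)) = 0) :
    OpZon (toyFrame n B N hN δ₀) Prod.fst Prod.fst id id (-1) (2 * ω₀ * Real.exp δ₀)
      (tdef (Matrix.diagonal h) (Matrix.diagonal h) (Dfw n B) (Dfw n B)) := by
  have h1 := dD_opZon hB hδ₀ hω₀ hmod hzone
  rw [cutX_id_id, show ω₀ * 1 * (2 * Real.exp δ₀) = 2 * ω₀ * Real.exp δ₀ by ring] at h1
  exact h1

end Classes

/-! ## §5 Cutoffs: the piecewise-linear ramp `hcut` (kinks of size `1/(MB)`) and the `C¹` cutoff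
`h₄ = sstep ∘ hcut` (modulus `3/(2M)`, SECOND modulus `6/M²` on the proper scale) -/

section Cutoffs

variable {n B M I₀ : ℕ}

/-- the ramp is monotone. [folklore] -/
theorem ramp_mono (hB : 0 < B) (hM : 0 < M) {x x' : ℝ} (h : x ≤ x') : ramp B M I₀ x ≤ ramp B M I₀ x' := by
  unfold ramp
  have hMB : (0 : ℝ) < M * B := by positivity
  exact max_le_max le_rfl (min_le_min le_rfl (div_le_div_of_nonneg_right (by linarith) hMB.le))

/-- one lattice step of the ramp: monotone, increment `≤ 1/(MB)`. [folklore] -/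
theorem ramp_step (hB : 0 < B) (hM : 0 < M) {y z : Fin n × Fin B} (hz : ι z = ι y + 1) :
    ramp B M I₀ (ι y) ≤ ramp B M I₀ (ι z) ∧ ramp B M I₀ (ι z) ≤ ramp B M I₀ (ι y) + (1 / M) * (B : ℝ)⁻¹ := by
  have hzr : (ι z : ℝ) = ι y + 1 := by exact_mod_cast hz
  refine ⟨ramp_mono hB hM (by linarith), ?_⟩
  have h1 := ramp_lipschitz hB hM (I₀ := I₀) (ι z : ℝ) (ι y)
  rw [hzr, show ((ι y : ℝ) + 1 - ι y) = 1 by ring, abs_one, mul_one] at h1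
  rw [hzr]
  linarith [(abs_le.1 h1).2]

/-- the ramp's TRICHOTOMY at a lattice position: `0`, `1`, or strictly inside the window where it is the
UNCLAMPED line. [folklore] -/
theorem ramp_trichotomy (hB : 0 < B) (hM : 0 < M) (t : ℕ) :
    ramp B M I₀ t = 0 ∨ ramp B M I₀ t = 1 ∨
      ((I₀ : ℝ) * B < t ∧ (t : ℝ) < (I₀ + M : ℝ) * B ∧ ramp B M I₀ t = ((t : ℝ) - I₀ * B) / (M * B)) := by
  by_cases h0 : (t : ℝ) ≤ I₀ * B
  · exact Or.inl (ramp_eq_zero_of_le hB hM h0)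
  · by_cases h1 : (I₀ + M : ℝ) * B ≤ t
    · exact Or.inr (Or.inl (ramp_eq_one_of_ge hB hM h1))
    · push Not at h0 h1
      exact Or.inr (Or.inr ⟨h0, h1, ramp_eq_of_mem hB hM h0.le h1.le⟩)

/-- [folklore] -/
theorem hcut_eq (e : Fin n × Fin B) : hcut n B M I₀ e = ramp B M I₀ (ι e) := by
  rw [hcut, pos_eq_ι]

/-- **THE KINKS OF THE RAMP**: its second differences are only `≤ 1/(MB) = (B/M)·B⁻²` — on the proper scale of
order `−2` the piecewise-linear cutoff has size `B/M`, NOT `O(M⁻²)` (census note: the *"O(M⁻²)"* clause of p. 414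
needs a smoother cutoff, §5's `h₄`). [folklore] -/
theorem abs_sd_hcut_le (hB : 0 < B) (hM : 0 < M) (x : Fin n × Fin B) :
    |sd (hcut n B M I₀) x| ≤ (1 / M) * (B : ℝ)⁻¹ := by
  have ha0 : (0 : ℝ) ≤ (1 / M) * (B : ℝ)⁻¹ := by positivity
  -- both one-step increments lie in `[0, a]`
  have hfd : 0 ≤ fd (hcut n B M I₀) x ∧ fd (hcut n B M I₀) x ≤ (1 / M) * (B : ℝ)⁻¹ := by
    rcases em (∃ y : Fin n × Fin B, ι y = ι x + 1) with ⟨y, hy⟩ | hx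
    · rw [fd_eq hy, hcut_eq, hcut_eq]
      have := ramp_step hB hM (I₀ := I₀) hy
      constructor <;> linarith [this.1, this.2]
    · rw [fd_eq_zero fun y hy => hx ⟨y, hy⟩]; exact ⟨le_rfl, ha0⟩
  have hbfd : 0 ≤ bfd (hcut n B M I₀) x ∧ bfd (hcut n B M I₀) x ≤ (1 / M) * (B : ℝ)⁻¹ := by
    rcases em (∃ w : Fin n × Fin B, ι x = ι w + 1) with ⟨w, hw⟩ | hx
    · rw [bfd_eq hw, fd_eq hw, hcut_eq, hcut_eq]
      have := ramp_step hB hM (I₀ := I₀) hw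
      constructor <;> linarith [this.1, this.2]
    · rw [bfd_eq_zero fun w hw => hx ⟨w, hw⟩]; exact ⟨le_rfl, ha0⟩
  rw [sd, abs_le]
  constructor <;> linarith [hfd.1, hfd.2, hbfd.1, hbfd.2]

/-- **… AND THE KINK IS ATTAINED**: at the left end of the ramp (`ι x = I₀B`, with `1 ≤ I₀`, window inside the
line) the second difference of `hcut` is EXACTLY `1/(MB) = (B/M)·B⁻²`: on the order-`−2` proper scale the
piecewise-linear cutoff's coefficient operator `Ξ` has size `B/M` at that row, not `O(M⁻²)` uniformly in `B`
(census note). [folklore] -/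
theorem sd_hcut_kink (hB : 0 < B) (hM : 0 < M) (hI₀ : 1 ≤ I₀) (hIM : I₀ + M < n) :
    ∃ x : Fin n × Fin B, sd (hcut n B M I₀) x = (1 / M) * (B : ℝ)⁻¹ := by
  have hIM' : I₀ + M + 1 ≤ n := hIM
  have hnB : (I₀ + M) * B + B ≤ n * B := by
    have := Nat.mul_le_mul_right B hIM'; rwa [Nat.add_mul, one_mul] at this
  have hMB1 : B ≤ M * B := Nat.le_mul_of_pos_left B hM
  have hsplit : (I₀ + M) * B = I₀ * B + M * B := Nat.add_mul _ _ _
  have hB1 : 1 ≤ B := hB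
  have h1B : 1 ≤ I₀ * B := by have := Nat.mul_le_mul hI₀ hB1; rwa [one_mul] at this
  have hlt : I₀ * B + 1 < n * B := by rw [hsplit] at hnB; omega
  obtain ⟨x, hιx⟩ : ∃ x : Fin n × Fin B, ι x = I₀ * B := ⟨site (I₀ * B) (by omega), ι_site _ _⟩
  obtain ⟨w, hw⟩ := exists_pred (y := x) (by omega)
  obtain ⟨y, hy⟩ := exists_succ (x := x) (by omega)
  refine ⟨x, ?_⟩
  rw [sd, bfd_eq hw, fd_eq hy, fd_eq hw, hcut_eq, hcut_eq, hcut_eq]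
  have hB' : (0 : ℝ) < B := by exact_mod_cast hB
  have hM' : (0 : ℝ) < M := by exact_mod_cast hM
  have hMB : (1 : ℝ) ≤ M * B := by exact_mod_cast (show 1 ≤ M * B from le_trans hB1 hMB1)
  have hxr : (ι x : ℝ) = I₀ * B := by rw [hιx]; push_cast; ring
  have hyr : (ι y : ℝ) = I₀ * B + 1 := by
    have : (ι y : ℝ) = ι x + 1 := by exact_mod_cast hy
    rw [this, hxr]
  have hwr : (ι w : ℝ) = I₀ * B - 1 := by
    have : (ι x : ℝ) = ι w + 1 := by exact_mod_cast hw
    linarith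
  have hexp : ((I₀ : ℝ) + M) * B = I₀ * B + M * B := by ring
  rw [hxr, hyr, hwr, ramp_eq_zero_of_le hB hM (x := (I₀ : ℝ) * B) le_rfl,
    ramp_eq_zero_of_le hB hM (x := (I₀ : ℝ) * B - 1) (by linarith),
    ramp_eq_of_mem hB hM (x := (I₀ : ℝ) * B + 1) (by linarith) (by linarith)]
  field_simp
  ring

/-- the smoothstep `f(r) = 3r² − 2r³`: `f(0) = 0`, `f(1) = 1`, `f′(0) = f′(1) = 0`, `|f′| ≤ 3/2` on `[0, 1]`.
OURS (typing). [folklore] -/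
def sstep (r : ℝ) : ℝ := 3 * r ^ 2 - 2 * r ^ 3

/-- [folklore] -/
theorem sstep_zero : sstep 0 = 0 := by norm_num [sstep]

/-- [folklore] -/
theorem sstep_one : sstep 1 = 1 := by norm_num [sstep]

/-- `f(r) ≤ 3r²` for `r ≥ 0`. [folklore] -/
theorem sstep_le_three_sq {r : ℝ} (hr : 0 ≤ r) : sstep r ≤ 3 * r ^ 2 := by
  unfold sstep; nlinarith [pow_nonneg hr 3]

/-- [folklore] -/
theorem sstep_nonneg {r : ℝ} (h1 : r ≤ 1) : 0 ≤ sstep r := by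
  unfold sstep; nlinarith [mul_nonneg (sq_nonneg r) (sub_nonneg.2 h1), sq_nonneg r]

/-- `1 − f(r) = (1 − r)²(1 + 2r)`. [folklore] -/
theorem one_sub_sstep (r : ℝ) : 1 - sstep r = (1 - r) ^ 2 * (1 + 2 * r) := by
  unfold sstep; ring

/-- `1 − f(r) ≤ 3(1 − r)²` on `[0, 1]`. [folklore] -/
theorem one_sub_sstep_le {r : ℝ} (h1 : r ≤ 1) : 1 - sstep r ≤ 3 * (1 - r) ^ 2 := by
  rw [one_sub_sstep]; nlinarith [mul_nonneg (sq_nonneg (1 - r)) (sub_nonneg.2 h1)]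

/-- [folklore] -/
theorem sstep_le_one {r : ℝ} (h0 : 0 ≤ r) : sstep r ≤ 1 := by
  have := one_sub_sstep r
  nlinarith [mul_nonneg (sq_nonneg (1 - r)) (by linarith : (0 : ℝ) ≤ 1 + 2 * r)]

/-- **`|f(s) − f(t)| ≤ (3/2)|s − t|` on `[0, 1]`** (`f(s) − f(t) = (s − t)·g`, `0 ≤ g ≤ 3/2` since
`3/2 − g = 2(p² + pq + q²)` with `p = s − ½`, `q = t − ½`). [folklore] -/
theorem sstep_lipschitz {s t : ℝ} (hs0 : 0 ≤ s) (hs1 : s ≤ 1) (ht0 : 0 ≤ t) (ht1 : t ≤ 1) :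
    |sstep s - sstep t| ≤ 3 / 2 * |s - t| := by
  have hg : sstep s - sstep t = (s - t) * (3 * (s + t) - 2 * (s ^ 2 + s * t + t ^ 2)) := by unfold sstep; ring
  have hg1 : 3 * (s + t) - 2 * (s ^ 2 + s * t + t ^ 2) ≤ 3 / 2 := by
    nlinarith [sq_nonneg (s + t - 1), sq_nonneg (s - t)]
  have hg0 : 0 ≤ 3 * (s + t) - 2 * (s ^ 2 + s * t + t ^ 2) := by
    nlinarith [mul_nonneg hs0 (sub_nonneg.2 hs1), mul_nonneg ht0 (sub_nonneg.2 ht1), mul_nonneg hs0 (sub_nonneg.2 ht1),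
      mul_nonneg ht0 (sub_nonneg.2 hs1)]
  rw [hg, abs_mul, abs_of_nonneg hg0, mul_comm]
  exact mul_le_mul_of_nonneg_right hg1 (abs_nonneg _)

/-- the symmetric second difference of the smoothstep: `f(v+a) − 2f(v) + f(v−a) = 6a²(1 − 2v)`. [folklore] -/
theorem sstep_second_diff (v a : ℝ) : sstep (v + a) - 2 * sstep v + sstep (v - a) = 6 * a ^ 2 * (1 - 2 * v) := by
  unfold sstep; ring

/-- **THE `C¹` CUTOFF `h₄ = f ∘ hcut`** (smoothstep of the ramp). OURS (typing). [folklore] -/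
def h4 (n B M I₀ : ℕ) (e : Fin n × Fin B) : ℝ := sstep (hcut n B M I₀ e)

/-- [folklore] -/
theorem h4_eq (e : Fin n × Fin B) : h4 n B M I₀ e = sstep (ramp B M I₀ (ι e)) := by
  rw [h4, hcut_eq]

/-- [folklore] -/
theorem h4_nonneg (e : Fin n × Fin B) : 0 ≤ h4 n B M I₀ e := sstep_nonneg (ramp_le_one _)

/-- [folklore] -/
theorem h4_le_one (e : Fin n × Fin B) : h4 n B M I₀ e ≤ 1 := sstep_le_one (ramp_nonneg _)

variable {N : Finset (Fin n)} {hN : N.Nonempty} {δ₀ : ℝ}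

/-- **CUTOFF FACT 1 (`CutModel.modulus` shape) for `h₄`** with `ω₀ = (3/2)·(1/M)`, for all pairs. [folklore] -/
theorem h4_modulus (hB : 0 < B) (hM : 0 < M) (ℓ : Fin n × Fin B → ℝ) :
    ∀ e e', dE n B e e' ≤ ℓ e → |h4 n B M I₀ e - h4 n B M I₀ e'| ≤
      (3 / 2 * (1 / M)) * ((toyFrame n B N hN δ₀).sc (id (Prod.fst e)))⁻¹ * dE n B e e' := by
  intro e e' _
  show _ ≤ (3 / 2 * (1 / M)) * (B : ℝ)⁻¹ * dE n B e e'
  unfold h4 hcut dE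
  calc |sstep (ramp B M I₀ (pos n B e)) - sstep (ramp B M I₀ (pos n B e'))|
      ≤ 3 / 2 * |ramp B M I₀ (pos n B e) - ramp B M I₀ (pos n B e')| :=
        sstep_lipschitz (ramp_nonneg _) (ramp_le_one _) (ramp_nonneg _) (ramp_le_one _)
    _ ≤ 3 / 2 * ((1 / M) * (B : ℝ)⁻¹ * |pos n B e - pos n B e'|) :=
        mul_le_mul_of_nonneg_left (ramp_lipschitz hB hM _ _) (by norm_num)
    _ = (3 / 2 * (1 / M)) * (B : ℝ)⁻¹ * |pos n B e - pos n B e'| := by ring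

/-- **CUTOFF FACT 1 for the ramp** in the toy frame (gen 14's `ramp_modulus`, re-read). [folklore] -/
theorem hcut_modulus (hB : 0 < B) (hM : 0 < M) (ℓ : Fin n × Fin B → ℝ) :
    ∀ e e', dE n B e e' ≤ ℓ e → |hcut n B M I₀ e - hcut n B M I₀ e'| ≤
      (1 / M) * ((toyFrame n B N hN δ₀).sc (id (Prod.fst e)))⁻¹ * dE n B e e' :=
  fun _ _ _ => ramp_lipschitz hB hM _ _

/-- **CUTOFF FACT 2 (`CutModel.zone` shape) for the ramp** in the toy frame. [folklore] -/
theorem hcut_zone (hB : 0 < B) (hM : 0 < M) (hN : (rampZone n M I₀).Nonempty) :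
    ∀ e e', dE n B e e' ≤ (fun _ => (B : ℝ)) e → hcut n B M I₀ e ≠ hcut n B M I₀ e' →
      (toyFrame n B (rampZone n M I₀) hN δ₀).β (id (Prod.fst e)) = 0 :=
  fun e e' hd hne => ramp_zone (δ₀ := δ₀) hB hM hN e e' hd hne

/-- **CUTOFF FACT 2 (`CutModel.zone` shape) for `h₄`** (it varies only where the ramp does). [folklore] -/
theorem h4_zone (hB : 0 < B) (hM : 0 < M) (hN : (rampZone n M I₀).Nonempty) :
    ∀ e e', dE n B e e' ≤ (fun _ => (B : ℝ)) e → h4 n B M I₀ e ≠ h4 n B M I₀ e' →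
      (toyFrame n B (rampZone n M I₀) hN δ₀).β (id (Prod.fst e)) = 0 := by
  intro e e' hd hne
  have hne' : hcut n B M I₀ e ≠ hcut n B M I₀ e' := fun h => hne (by rw [h4, h4, h])
  exact ramp_zone (δ₀ := δ₀) hB hM hN e e' hd hne'

/-- **CUTOFF FACT 3 (`CutModel.farS₁` shape) for `h₄`**. [folklore] -/
theorem h4_far (hB : 0 < B) (hM : 0 < M) (I : Fin n) (hI : ¬ I₀ ≤ I.val + 2) (o₀ : Fin B) (ho₀ : o₀.val = 0) :
    ∀ e', dE n B (I, o₀) e' ≤ (fun _ => (B : ℝ)) (I, o₀) → h4 n B M I₀ e' = 0 := by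
  intro e' hd
  rw [h4, ramp_far hB hM I hI o₀ ho₀ e' hd, sstep_zero]

/-- **SECOND DIFFERENCES OF THE `C¹` CUTOFF: `|ξ_{h₄}(x)| ≤ 6/(MB)²`** for a window inside the line
(`I₀ + M < n`).  Trichotomy at `v = hcut(x)`: `v = 0` (then `θ(x − 1) = 0` and `θ(x) = f(w) ≤ 3w² ≤ 3a²`);
`v = 1` (then `θ(x) = 0` and `θ(x−1) = 1 − f(u) ≤ 3(1 − u)² ≤ 3a²`); or `v` strictly inside, where by
INTEGRALITY of the positions both neighbours are unclamped, `= v ∓ a`, and `f(v+a) − 2f(v) + f(v−a) = 6a²(1 − 2v)`;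
here `a = 1/(MB)`. [folklore] -/
theorem abs_sd_h4_le (hB : 0 < B) (hM : 0 < M) (hIM : I₀ + M < n) (x : Fin n × Fin B) :
    |sd (h4 n B M I₀) x| ≤ 6 * ((1 / M) * (B : ℝ)⁻¹) ^ 2 := by
  set a : ℝ := (1 / M) * (B : ℝ)⁻¹ with ha
  have hB' : (0 : ℝ) < B := by exact_mod_cast hB
  have hM' : (0 : ℝ) < M := by exact_mod_cast hM
  have ha0 : 0 ≤ a := by positivity
  have ha2 : 0 ≤ a ^ 2 := sq_nonneg a
  rcases ramp_trichotomy hB hM (I₀ := I₀) (ι x) with h0 | h1 | ⟨hl, hr, hv⟩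
  · -- `v = 0`
    have hbfd : bfd (h4 n B M I₀) x = 0 := by
      rcases em (∃ w : Fin n × Fin B, ι x = ι w + 1) with ⟨w, hw⟩ | hx
      · rw [bfd_eq hw, fd_eq hw, h4_eq, h4_eq, h0]
        have hu : ramp B M I₀ (ι w) = 0 :=
          le_antisymm ((ramp_step hB hM (I₀ := I₀) hw).1.trans_eq h0) (ramp_nonneg _)
        rw [hu, sub_self]
      · exact bfd_eq_zero fun w hw => hx ⟨w, hw⟩
    have hfd : 0 ≤ fd (h4 n B M I₀) x ∧ fd (h4 n B M I₀) x ≤ 3 * a ^ 2 := by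
      rcases em (∃ y : Fin n × Fin B, ι y = ι x + 1) with ⟨y, hy⟩ | hx
      · rw [fd_eq hy, h4_eq, h4_eq, h0, sstep_zero, sub_zero]
        have hw0 : 0 ≤ ramp B M I₀ (ι y) := ramp_nonneg _
        have hwa : ramp B M I₀ (ι y) ≤ a := by have := (ramp_step hB hM (I₀ := I₀) hy).2; rw [h0] at this; linarith
        refine ⟨sstep_nonneg (ramp_le_one _), (sstep_le_three_sq hw0).trans ?_⟩
        nlinarith [mul_self_le_mul_self hw0 hwa]
      · rw [fd_eq_zero fun y hy => hx ⟨y, hy⟩]; exact ⟨le_rfl, by positivity⟩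
    rw [sd, hbfd, sub_zero, abs_of_nonneg hfd.1]
    linarith [hfd.2]
  · -- `v = 1`
    have hfd : fd (h4 n B M I₀) x = 0 := by
      rcases em (∃ y : Fin n × Fin B, ι y = ι x + 1) with ⟨y, hy⟩ | hx
      · rw [fd_eq hy, h4_eq, h4_eq, h1]
        have hw : ramp B M I₀ (ι y) = 1 :=
          le_antisymm (ramp_le_one _) (h1.symm.trans_le (ramp_step hB hM (I₀ := I₀) hy).1)
        rw [hw, sub_self]
      · exact fd_eq_zero fun y hy => hx ⟨y, hy⟩
    have hbfd : 0 ≤ bfd (h4 n B M I₀) x ∧ bfd (h4 n B M I₀) x ≤ 3 * a ^ 2 := by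
      rcases em (∃ w : Fin n × Fin B, ι x = ι w + 1) with ⟨w, hw⟩ | hx
      · rw [bfd_eq hw, fd_eq hw, h4_eq, h4_eq, h1, sstep_one]
        have hu1 : ramp B M I₀ (ι w) ≤ 1 := ramp_le_one _
        have hua : 1 - a ≤ ramp B M I₀ (ι w) := by
          have := (ramp_step hB hM (I₀ := I₀) hw).2; rw [h1] at this; linarith
        refine ⟨by linarith [sstep_le_one (ramp_nonneg (B := B) (M := M) (I₀ := I₀) (ι w : ℝ))],
          (one_sub_sstep_le hu1).trans ?_⟩
        nlinarith [mul_self_le_mul_self (sub_nonneg.2 hu1) (by linarith : 1 - ramp B M I₀ (ι w) ≤ a)]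
      · rw [bfd_eq_zero fun w hw => hx ⟨w, hw⟩]; exact ⟨le_rfl, by positivity⟩
    rw [sd, hfd, zero_sub, abs_neg, abs_of_nonneg hbfd.1]
    linarith [hbfd.2]
  · -- `v` strictly inside: both neighbours exist and are unclamped
    have hln : I₀ * B < ι x := by exact_mod_cast hl
    have hrn : ι x < (I₀ + M) * B := by exact_mod_cast hr
    have hIM' : I₀ + M + 1 ≤ n := hIM
    have hnB : (I₀ + M) * B + B ≤ n * B := by
      have := Nat.mul_le_mul_right B hIM'; rwa [Nat.add_mul, one_mul] at this
    obtain ⟨w, hw⟩ := exists_pred (show 0 < ι x by omega)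
    obtain ⟨y, hy⟩ := exists_succ (show ι x + 1 < n * B by linarith)
    have hwr : (ι w : ℝ) = ι x - 1 := by
      have : (ι x : ℝ) = ι w + 1 := by exact_mod_cast hw
      linarith
    have hyr : (ι y : ℝ) = ι x + 1 := by exact_mod_cast hy
    have hw1 : (I₀ : ℝ) * B ≤ ι w := by
      have h' := hln
      rw [hw] at h'
      have : I₀ * B ≤ ι w := Nat.lt_succ_iff.1 h'
      exact_mod_cast this
    have hw2 : (ι w : ℝ) ≤ (I₀ + M : ℝ) * B := by linarith
    have hy1 : (I₀ : ℝ) * B ≤ ι y := by linarith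
    have hy2 : (ι y : ℝ) ≤ (I₀ + M : ℝ) * B := by
      have : ι y ≤ (I₀ + M) * B := by rw [hy]; exact Nat.succ_le_of_lt hrn
      exact_mod_cast this
    have hMB : (0 : ℝ) < M * B := by positivity
    have ha' : a = 1 / (M * B) := by rw [ha]; field_simp
    have hu : ramp B M I₀ (ι w) = ramp B M I₀ (ι x) - a := by
      rw [ramp_eq_of_mem hB hM hw1 hw2, hv, hwr, ha']; field_simp; ring
    have hz : ramp B M I₀ (ι y) = ramp B M I₀ (ι x) + a := by
      rw [ramp_eq_of_mem hB hM hy1 hy2, hv, hyr, ha']; field_simp; ring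
    have hsd : sd (h4 n B M I₀) x = 6 * a ^ 2 * (1 - 2 * ramp B M I₀ (ι x)) := by
      rw [sd, bfd_eq hw, fd_eq hy, fd_eq hw, h4_eq, h4_eq, h4_eq, hu, hz, ← sstep_second_diff]
      ring
    rw [hsd]
    have hv0 := ramp_nonneg (B := B) (M := M) (I₀ := I₀) (ι x : ℝ)
    have hv1 := ramp_le_one (B := B) (M := M) (I₀ := I₀) (ι x : ℝ)
    rw [abs_le]
    constructor <;> nlinarith

end Cutoffs

/-! ## §6 THE LEIBNIZ BLOCK OF THE CUT MODEL, INHABITED ON THE TOY LINE WITH `∂ ≠ 0` AND THE `C¹` CUTOFF -/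

section Block

variable {n B M I₀ : ℕ} {δ₀ : ℝ}

/-- the one (L) constant of the block: `θ_L = (3/2)(1/M)(1 + e^{δ₀}) + 6/M²` — `O(M⁻¹)`, uniform in `B`, `n`,
`I₀`. OURS (typing). [folklore] -/
def thetaL (M : ℕ) (δ₀ : ℝ) : ℝ := 3 / 2 * (1 / M) * (1 + Real.exp δ₀) + 6 * (1 / (M : ℝ)) ^ 2

/-- [folklore] -/
theorem thetaL_nonneg : 0 ≤ thetaL M δ₀ := by unfold thetaL; positivity

/-- [folklore] -/
theorem lt_of_hIM (hIM : I₀ + M < n) : I₀ < n := lt_of_le_of_lt (Nat.le_add_right _ _) hIM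

/-- **(L1) the first-order coefficient of `h₄`: `Θ + SᵀΘ ∈ 𝒵(−1, θ_L)`** on the toy frame of the ramp zone (any
block maps over the block projection — sequence 1 `Prod.fst / id` and sequence 2 `bs2 / p2` alike). OURS.
[cite: Balaban1985BackgroundPropagators, p.414 + (3.100) p.413] -/
theorem h4_zLm₁ (hB : 0 < B) (hM : 0 < M) (hIM : I₀ + M < n) (hδ₀ : 0 < δ₀) {U V : Type*} [DecidableEq V]
    {bu : Fin n × Fin B → U} {bv : Fin n × Fin B → V} {pU : U → Fin n} {pV : V → Fin n}
    (hbu : ∀ x, pU (bu x) = x.1) (hbv : ∀ x, pV (bv x) = x.1) :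
    OpZon (toyFrame n B (rampZone n M I₀) (rampZone_nonempty (lt_of_hIM hIM)) δ₀) bu bv pU pV (-1) (thetaL M δ₀)
      (Th (h4 n B M I₀) + (Sh n B).transpose * Th (h4 n B M I₀)) := by
  have hN := rampZone_nonempty (n := n) (M := M) (lt_of_hIM hIM)
  refine B9SectCDiffDict.opZon_mono (toyFrame_valid hB hN hδ₀)
    (opZon_Lm₁ hB hδ₀ (by positivity) hbu hbv (h4_modulus hB hM _) (h4_zone hB hM hN)) (by positivity) ?_
  unfold thetaL
  have : 0 ≤ 6 * (1 / (M : ℝ)) ^ 2 := by positivity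
  linarith

/-- **(L0) the second-order coefficient of `h₄`: `Ξ ∈ 𝒵(−2, θ_L)`**. OURS.
[cite: Balaban1985BackgroundPropagators, p.414 + (3.100) p.413] -/
theorem h4_zLm₀ (hB : 0 < B) (hM : 0 < M) (hIM : I₀ + M < n) (hδ₀ : 0 < δ₀) {U V : Type*} [DecidableEq V]
    {bu : Fin n × Fin B → U} {bv : Fin n × Fin B → V} {pU : U → Fin n} {pV : V → Fin n}
    (hbu : ∀ x, pU (bu x) = x.1) (hbv : ∀ x, pV (bv x) = x.1) :
    OpZon (toyFrame n B (rampZone n M I₀) (rampZone_nonempty (lt_of_hIM hIM)) δ₀) bu bv pU pV (-2) (thetaL M δ₀)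
      (Xi (h4 n B M I₀)) := by
  have hN := rampZone_nonempty (n := n) (M := M) (lt_of_hIM hIM)
  have hξ : ∀ x, |sd (h4 n B M I₀) x| ≤ 6 * (1 / (M : ℝ)) ^ 2 * ((B : ℝ) ^ 2)⁻¹ := fun x => by
    have h1 := abs_sd_h4_le hB hM hIM x
    have hB' : (0 : ℝ) < B := by exact_mod_cast hB
    calc |sd (h4 n B M I₀) x| ≤ 6 * ((1 / M) * (B : ℝ)⁻¹) ^ 2 := h1
      _ = 6 * (1 / (M : ℝ)) ^ 2 * ((B : ℝ) ^ 2)⁻¹ := by rw [mul_pow, inv_pow]; ring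
  refine B9SectCDiffDict.opZon_mono (toyFrame_valid hB hN hδ₀)
    (opZon_Xi hB hδ₀ (by positivity) hbu hbv (h4_zone hB hM hN) hξ) (by positivity) ?_
  unfold thetaL
  have : 0 ≤ 3 / 2 * (1 / (M : ℝ)) * (1 + Real.exp δ₀) := by positivity
  linarith

/-- **(L) the `hM` coefficient `SᵀΘ ∈ 𝒵(−1, θ_L)`**. OURS. [cite: Balaban1985BackgroundPropagators, p.414] -/
theorem h4_zDm₁ (hB : 0 < B) (hM : 0 < M) (hIM : I₀ + M < n) (hδ₀ : 0 < δ₀) {U V : Type*} [DecidableEq V]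
    {bu : Fin n × Fin B → U} {bv : Fin n × Fin B → V} {pU : U → Fin n} {pV : V → Fin n}
    (hbu : ∀ x, pU (bu x) = x.1) (hbv : ∀ x, pV (bv x) = x.1) :
    OpZon (toyFrame n B (rampZone n M I₀) (rampZone_nonempty (lt_of_hIM hIM)) δ₀) bu bv pU pV (-1) (thetaL M δ₀)
      ((Sh n B).transpose * Th (h4 n B M I₀)) := by
  have hN := rampZone_nonempty (n := n) (M := M) (lt_of_hIM hIM)
  refine B9SectCDiffDict.opZon_mono (toyFrame_valid hB hN hδ₀)
    (opZon_transpose_mul_Th hB hδ₀ (by positivity) hbu hbv (h4_modulus hB hM _) (h4_zone hB hM hN))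
    (by positivity) ?_
  unfold thetaL
  have h1 : 0 ≤ 6 * (1 / (M : ℝ)) ^ 2 := by positivity
  have h2 : 0 ≤ 3 / 2 * (1 / (M : ℝ)) := by positivity
  nlinarith [Real.exp_pos δ₀]

/-- **the ramp's second-order coefficient is only `Ξ_{hcut} ∈ 𝒵(−2, B/M)`** (the kinks, `abs_sd_hcut_le` /
`sd_hcut_kink`): a `B`-DEPENDENT constant — recorded as the reason for the `C¹` cutoff `h₄`. OURS.
[cite: Balaban1985BackgroundPropagators, p.414] -/
theorem hcut_zXi (hB : 0 < B) (hM : 0 < M) (hI₀ : I₀ < n) (hδ₀ : 0 < δ₀) {U V : Type*} [DecidableEq V]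
    {bu : Fin n × Fin B → U} {bv : Fin n × Fin B → V} {pU : U → Fin n} {pV : V → Fin n}
    (hbu : ∀ x, pU (bu x) = x.1) (hbv : ∀ x, pV (bv x) = x.1) :
    OpZon (toyFrame n B (rampZone n M I₀) (rampZone_nonempty hI₀) δ₀) bu bv pU pV (-2) ((B : ℝ) / M)
      (Xi (hcut n B M I₀)) := by
  have hN := rampZone_nonempty (n := n) (M := M) hI₀
  have hB' : (0 : ℝ) < B := by exact_mod_cast hB
  refine opZon_Xi hB hδ₀ (by positivity) hbu hbv (hcut_zone hB hM hN) fun x => ?_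
  calc |sd (hcut n B M I₀) x| ≤ (1 / M) * (B : ℝ)⁻¹ := abs_sd_hcut_le hB hM x
    _ = (B : ℝ) / M * ((B : ℝ) ^ 2)⁻¹ := by field_simp

/-- **THE LEIBNIZ BLOCK WITH CONTENT** — the `hΛ / hM / hA` identities of `CutModel` for `Λ = a·1 + b·∂∂*`,
`Δ′ = ∂*∂ + m²·1` with the `C¹` cutoff `h₄`, all three with the SAME coefficient operators `Lm₁ = b(Θ + SᵀΘ)`,
`Dm₁ = SᵀΘ`, `Am₁ = Θ + SᵀΘ` (order −1) and `Lm₀ = bΞ`, `Dm₀ = Am₀ = Ξ` (order −2), `Dv = ∂`: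
exact for every cutoff `h` (§2), in the zone classes `𝒵(−1, θ_L)`, `𝒵(−2, θ_L)` for `h = h₄` (§6, at `b = 1`:
`h4_zLm₁`/`h4_zLm₀` type the unit-coefficient operators `Θ + SᵀΘ` / `Ξ`; a general `|b| ≤ 1` would need a scaling lemma
for the zone classes `𝒵`, absent from this closure — v1.1 DOCFIX m1, XREAD adv1-g48 C-A54-1; no declaration changed).
OURS. [cite: Balaban1985BackgroundPropagators, (3.100) p.413 + p.414] -/
theorem leibniz_affine (h : Fin n × Fin B → ℝ) (a b m2 : ℝ) :
    tdef (Matrix.diagonal h) (Matrix.diagonal h) (a • (1 : Matrix _ _ ℝ) + b • (Dfw n B * Dbw n B))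
        (a • (1 : Matrix _ _ ℝ) + b • (Dfw n B * Dbw n B)) =
      (b • (Th h + (Sh n B).transpose * Th h)) * Dfw n B + b • Xi h ∧
    Dfw n B * tdef (Matrix.diagonal h) (Matrix.diagonal h) (Dbw n B) (Dbw n B) =
      ((Sh n B).transpose * Th h) * Dfw n B + Xi h ∧
    tdef (Matrix.diagonal h) (Matrix.diagonal h) (Dbw n B * Dfw n B + m2 • (1 : Matrix _ _ ℝ))
        (Dbw n B * Dfw n B + m2 • (1 : Matrix _ _ ℝ)) =
      (Th h + (Sh n B).transpose * Th h) * Dfw n B + Xi h := by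
  refine ⟨?_, D_mul_dDt h, ?_⟩
  · rw [B9SectCDiff.tdef_add, B9SectCDiff.tdef_smul, B9SectCDiff.tdef_one, smul_zero, zero_add,
      B9SectCDiff.tdef_smul, dDDt_eq, smul_add, Matrix.smul_mul]
  · rw [B9SectCDiff.tdef_add, B9SectCDiff.tdef_smul, B9SectCDiff.tdef_one, smul_zero, add_zero, dDtD_eq]

end Block

end

end Literature.MathematicalPhysics.QuantumFieldTheory.Balaban1983to89.B9SectCDiffCutModelToy4
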